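import Literature.Geometry.Kaehler.ComplexTorusExtendedMumfordTateGroupFunctoriality
import Literature.Geometry.Kaehler.ComplexTorusHodgeGroupProductNonCMEllipticCurves
import Literature.Geometry.Kaehler.ComplexTorusProductPowerIsomorphisms
import HarnessLib

/-!
# The Mumford–Tate group and the extended Mumford–Tate group of a product of two elliptic curves (Moonen 2004,
# Exercise (5.6)), and when `M̃T(X₁ × X₂) ⊂ M̃T(X₁) ×_{𝔾_m} M̃T(X₂)` is an equality — at torus level

[cite: Moonen2004MT, §5 (5.6) Exercise with its Hint (p. 12); §4 Lemma 4.6, (4.7), (4.8); §5 (5.2), (5.8)]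
[cite: Moonen1999MTNotes, (1.11), (1.13), (1.14)] [cite: Imai1976HodgeGroups, §2 Proposition (p. 368) and §3 Remarks (p. 370)]
[cite: MoonenZarhin1999LowDim, §3 Corollary] [cite: CarlsonMullerStachPeters2017, §15.2 Examples 15.2.4 (ii)]
[cite: Lombardo2019, §2.2, cases 5 and 6 (arXiv:1610.09674 p. 4)]

Moonen's notes *An introduction to Mumford–Tate groups* (2004) close §5 with

> **(5.6) Exercise.** Consider a product `X = E₁ × E₂` of two elliptic curves. Make a list of possible
> combinations for `End⁰(E₁)` and `End⁰(E₂)`. In each case, try to determine the Mumford-Tate group of `X`. [Hint: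
> Writing `V_i := H¹(E_i, ℚ)`, use that `E₁` and `E₂` are isogenous if and only if there is a non-zero homomorphism
> of Hodge structures `V₁ → V₂`, i.e., a non-zero Hodge class in `Hom(V₁, V₂)`.]

and Moonen's 1999 notes record, for Hodge structures `V₁`, `V₂` and `V = V₁ ⊕ V₂`,

> **(1.13) Remark.** […] `Hg(V) ⊆ Hg(V₁) × Hg(V₂)`. This need not be an equality […] For the Mumford-Tate group
> similar statements hold, but note that `MT(V)` is almost never equal to `MT(V₁) × MT(V₂)`, as the central
> factor `𝔾_m = 𝔾_m · id` is counted twice in `MT(V₁) × MT(V₂)`.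
> **(1.11)** […] `MT(V)` is the almost direct product (inside `GL(V)`) of `𝔾_{m,ℚ}` and `Hg(V)`.

The printed answer (Lombardo, *Computing the geometric endomorphism ring of a genus-2 Jacobian*, §2.2): "5. … `A` is
geometrically isogenous to the product of two non-isogenous elliptic curves `E₁` and `E₂` that furthermore satisfy
`End⁰(E_i) = F_i`. The Mumford-Tate group has rank 3, and it is isomorphic to `𝔾_m · (M₁ × M₂)`, where `M_i = SL_{2,ℚ}`
if `F_i = ℚ`, `M_i = {x ∈ Res_{F_i/ℚ}(𝔾_m) | x x̄ = 1}` if `F_i` is imaginary quadratic. […] 6. … `A` is geometrically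
isogenous to the square of an elliptic curve `E` […] The Mumford-Tate group is `𝔾_m · {(x, x) | x ∈ M}`."

This file solves the exercise at TORUS LEVEL — on points of the tree's point-set Mumford–Tate group `MT(X)(K)`
(`Literature…ComplexTorusMumfordTateGroup`) and extended Mumford–Tate group `M̃T(X)(K) ⊂ GL(V ⊕ ℚ(1))(K)`
(`Literature…ComplexTorusExtendedMumfordTateGroup`, Q994), `K = ℝ, ℂ` — and, on the way, determines exactly when
Moonen's inclusion `M̃T(X₁ × X₂) ⊂ M̃T(X₁) ×_{𝔾_m} M̃T(X₂)` of the tree's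
`ComplexTorusExtendedMumfordTateGroupFunctoriality` (`extMumfordTateGroup_prod_le`) is an equality. In the
extended group the central factor is counted ONCE, so the only defect left is that of the Hodge groups:

* §1 **The criterion** (complex tori `X₁`, `X₂` of any dimensions carrying rational `(1,1)`-classes with nonzero
  Gram matrices, e.g. polarised abelian varieties; complex points):
  **`M̃T(X₁ × X₂)(ℂ) = M̃T(X₁)(ℂ) ×_{ℂ^×} M̃T(X₂)(ℂ) ⟺ Hg(X₁ × X₂)(ℂ) = Hg(X₁)(ℂ) × Hg(X₂)(ℂ)`**
  (`extMumfordTateGroupC_prod_eq_iff_hodgeGroupC_prod_eq`), with the `MT`-level reading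
  `(A 0; 0 B) ∈ MT(X₁ × X₂) ⟺ ∃ c, (A, c) ∈ M̃T(X₁) ∧ (B, c) ∈ M̃T(X₂)` — `MT(X₁ × X₂) = MT(X₁) ×_{𝔾_m} MT(X₂)` over the
  multiplier characters (`blockDiagGL_mem_mumfordTateGroupC_prod_iff_of_forall_blockDiagC_mem`, real points
  `blockDiagGL_mem_mumfordTateGroup_prod_iff_of_forall_blockDiagC_mem`, `extMumfordTateGroup_prod_eq_of_hodgeGroupC_prod_eq`).
  Mechanism: Q994 §5 `M̃T(X)(ℂ) = {(c · N, c²) : N ∈ Hg(X)(ℂ)}`, so a point of the fibre product is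
  `((c N₁, ±c N₂), c²) = (c · (N₁, ±N₂), c²)` with `(N₁, ±N₂) ∈ Hg(X₁ × X₂)(ℂ)` (`−1 = h₂(e^{iπ}) ∈ Hg(X₂)`); conversely
  `((N₁, N₂), 1) ∈ M̃T(X₁ × X₂)(ℂ)` forces `(N₁, N₂) ∈ Hg(X₁ × X₂)(ℂ)` (Deligne's `G⁰ = Ker(G → 𝔾_m)`, Q994 §8).
* §2 **Strictness**: a nonzero `B ∈ Hom_ℚ(X₁, X₂)` (e.g. an isogeny) gives `(1, −1) ∉ MT(X₁ × X₂)` although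
  `((1, −1), 1) ∈ M̃T(X₁) ×_{𝔾_m} M̃T(X₂)` — the graph relation `N₂ B = B N₁` on `Hg(X₁ × X₂)(ℂ)` (Imai's
  "`Hg(E₁ × E₂) = {(x, λxλ⁻¹)}`", the tree's `snd_mul_eq_mul_fst_of_blockDiagC_mem_hodgeGroupC_prod`) would give
  `−B = B`; hence `extMumfordTateGroup_prod_lt_of_homRat_ne_bot`, `IsIsogenous.extMumfordTateGroup_prod_lt`; and for
  isogenous tori `M̃T(X₁ × X₂)(ℝ) ≅ M̃T(X₁)(ℝ)` (`IsIsogenous.nonempty_extMumfordTateGroup_prod_mulEquiv`: `X₁ × X₂ ~ X₁²`,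
  isogeny invariance and `M̃T(X²) ≅ M̃T(X)` from the functoriality file).
* §3 **Exercise (5.6)** for the elliptic curves `E_τ = ℂ/(ℤτ + ℤ)` of the tree (`ellipticPeriod`), real points.
  For EVERY curve `(A, t) ∈ M̃T(E_τ)(ℝ) ⟺ A ∈ MT(E_τ)(ℝ) ∧ det A = t` (`ν = det`, `GSp₂ = GL₂`), and for every pair
  `det A = det B` on `MT(E_τ₁ × E_τ₂)(ℝ)`. For NON-ISOGENOUS curves — all four combinations `End⁰(Eᵢ) ∈ {ℚ, Kᵢ}` at
  once —
  **`MT(E_τ₁ × E_τ₂)(ℝ) = {(A 0; 0 B) : A ∈ MT(E_τ₁)(ℝ), B ∈ MT(E_τ₂)(ℝ), det A = det B}`**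
  (`mem_mumfordTateGroup_prod_ellipticPeriod_iff_of_not_isIsogenous`; with `MT(E_τ)(ℝ) = GL₂(ℝ)` without CM and
  `= {h(z) : z ∈ ℂ^×} = (K ⊗ ℝ)^×` with CM, the tree's CMSP 15.2.4 (ii), this is Moonen's list
  `GL₂ ×_{det} GL₂`, `GL₂ ×_{det,Nm} T_K`, `T_{K₁} ×_{Nm} T_{K₂}`), and
  **`M̃T(E_τ₁ × E_τ₂)(ℝ) = M̃T(E_τ₁)(ℝ) ×_{ℝ^×} M̃T(E_τ₂)(ℝ)`** — EQUALITY in (1.13)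
  (`extMumfordTateGroup_prod_ellipticPeriod_eq_of_not_isIsogenous`), while for ISOGENOUS curves the inclusion is
  proper (`extMumfordTateGroup_prod_ellipticPeriod_eq_iff_not_isIsogenous`,
  `blockDiagGL_one_neg_one_not_mem_mumfordTateGroup_prod_ellipticPeriod_of_isIsogenous`; there `M̃T(E × E′) ≅ M̃T(E)`,
  §2, the graph up to the centre — compare the tree's `mem_mumfordTateGroup_pi_iff_isogenyRep` for powers). Inputs: Imai's
  Proposition at torus level (the tree's `hodgeGroup_prod_ellipticPeriod_eq_of_not_isIsogenous'`, real points, all CM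
  types; `hodgeGroupC_prod_ellipticPeriod_eq_of_eq_bot_of_eq_bot`, complex points, no CM) — with a CM factor the
  common determinant is `|z|² > 0` and `(A, B) = r · (a, b)` with `(a, b) ∈ Hg(E_τ₁)(ℝ) × Hg(E_τ₂)(ℝ)`; without CM
  `det` may be negative and §1 (complex scalars) is used. Complex points without CM:
  `M̃T(E_τ₁ × E_τ₂)(ℂ) = GL₂(ℂ) ×_{det} GL₂(ℂ)` and `MT(E_τ₁ × E_τ₂)(ℂ) = {(A 0; 0 B) : det A = det B}`
  (`extGL_blockDiagGL_mem_extMumfordTateGroupC_prod_ellipticPeriod_iff_of_eq_bot_of_eq_bot`,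
  `blockDiagGL_mem_mumfordTateGroupC_prod_ellipticPeriod_iff_of_eq_bot_of_eq_bot`).

No new named facts (net debt 0); imports from `Literature/` and Mathlib only. NOT claimed: an explicit matrix
description of `MT(E × E′)(ℝ)` inside `GL₂ × GL₂` for isogenous `E ~ E′` (only `M̃T(E × E′) ≅ M̃T(E)` abstractly and
the strictness); three or more curves; surjectivity of `M̃T(X₁ × X₂) → M̃T(Xᵢ)` on points (Chevalley).
-/

noncomputable section

open scoped Real
open Set Function Complex Module Matrix

namespace Literature.Geometry.Kaehler

namespace ComplexTorus

/-! ## §1 The criterion: `M̃T(X₁ × X₂)(ℂ) = M̃T(X₁)(ℂ) ×_{ℂ^×} M̃T(X₂)(ℂ)` iff `Hg(X₁ × X₂)(ℂ) = Hg(X₁)(ℂ) × Hg(X₂)(ℂ)` -/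

section Criterion

variable {ι₁ ι₂ : Type*} [Fintype ι₁] [Fintype ι₂] [DecidableEq ι₁] [DecidableEq ι₂]
  {E₁ E₂ : Type*} [NormedAddCommGroup E₁] [NormedSpace ℂ E₁] [NormedAddCommGroup E₂] [NormedSpace ℂ E₂]
  (Φ₁ : (ι₁ → ℝ) ≃L[ℝ] E₁) (Φ₂ : (ι₂ → ℝ) ≃L[ℝ] E₂)

/-- **The fibre product `M̃T(X₁)(ℂ) ×_{ℂ^×} M̃T(X₂)(ℂ)` on complex points**: the pairs `((g₁, g₂), c)` with
`(g₁, c) ∈ M̃T(X₁)(ℂ)` and `(g₂, c) ∈ M̃T(X₂)(ℂ)` (the complex-points companion of the tree's `extFiberProd`).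
[cite: Moonen1999MTNotes, (1.13) and (1.14)] [cite: Moonen2004MT, §4 Lemma 4.6 and (4.7)] -/
def extFiberProdC : Subgroup ((GL ι₁ ℂ × GL ι₂ ℂ) × ℂˣ) :=
  (extMumfordTateGroupC Φ₁).comap ((extGL ι₁ ℂ).comp ((MonoidHom.fst (GL ι₁ ℂ) (GL ι₂ ℂ)).prodMap (MonoidHom.id ℂˣ))) ⊓
    (extMumfordTateGroupC Φ₂).comap ((extGL ι₂ ℂ).comp ((MonoidHom.snd (GL ι₁ ℂ) (GL ι₂ ℂ)).prodMap (MonoidHom.id ℂˣ)))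

/-- Membership in the complex fibre product. [cite: Moonen1999MTNotes, (1.13), (1.14)] -/
theorem mem_extFiberProdC_iff {x : (GL ι₁ ℂ × GL ι₂ ℂ) × ℂˣ} :
    x ∈ extFiberProdC Φ₁ Φ₂ ↔
      extGL ι₁ ℂ (x.1.1, x.2) ∈ extMumfordTateGroupC Φ₁ ∧ extGL ι₂ ℂ (x.1.2, x.2) ∈ extMumfordTateGroupC Φ₂ :=
  Iff.rfl

/-- **`M̃T(X₁ × X₂)(ℂ) ⊆ M̃T(X₁)(ℂ) ×_{ℂ^×} M̃T(X₂)(ℂ)`** (complex points of Moonen's (1.13) for `M̃T`; the tree's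
`exists_eq_extGL_blockDiagGL_of_mem_extMumfordTateGroupC_prod`). [cite: Moonen1999MTNotes, (1.13), (1.14)]
[cite: Moonen2004MT, §4 Lemma 4.6 and (4.7)] -/
theorem extMumfordTateGroupC_prod_le :
    extMumfordTateGroupC (prodPeriod Φ₁ Φ₂) ≤ (extFiberProdC Φ₁ Φ₂).map (extProdGL ι₁ ι₂ ℂ) := by
  intro g hg
  obtain ⟨g₁, g₂, c, rfl, h₁, h₂⟩ := exists_eq_extGL_blockDiagGL_of_mem_extMumfordTateGroupC_prod Φ₁ Φ₂ hg
  exact ⟨((g₁, g₂), c), (mem_extFiberProdC_iff Φ₁ Φ₂).2 ⟨h₁, h₂⟩, rfl⟩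

/-- **`Hg(X₁ × X₂)(ℂ) ⊆ Hg(X₁)(ℂ) × Hg(X₂)(ℂ)`** as subgroups of `SL(V₁ ⊕ V₂)(ℂ)` (the tree's
`exists_eq_blockDiagC_of_mem_hodgeGroupC_prod`, in `map`/`prod` form). [cite: Moonen1999MTNotes, (1.13) ("`Hg(V) ⊆ Hg(V₁) × Hg(V₂)`")]
[cite: Imai1976HodgeGroups, §1 (p. 367)] -/
theorem hodgeGroupC_prod_le_map_blockDiagC :
    hodgeGroupC (prodPeriod Φ₁ Φ₂) ≤ ((hodgeGroupC Φ₁).prod (hodgeGroupC Φ₂)).map (blockDiagC ι₁ ι₂) := by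
  intro N hN
  obtain ⟨N₁, hN₁, N₂, hN₂, rfl⟩ := exists_eq_blockDiagC_of_mem_hodgeGroupC_prod Φ₁ Φ₂ hN
  exact ⟨(N₁, N₂), Subgroup.mem_prod.2 ⟨hN₁, hN₂⟩, rfl⟩

/-- `Hg(X₁ × X₂)(ℂ) = Hg(X₁)(ℂ) × Hg(X₂)(ℂ)` iff every block-diagonal `(N₁ 0; 0 N₂)` with `Nᵢ ∈ Hg(Xᵢ)(ℂ)` lies in
`Hg(X₁ × X₂)(ℂ)`. [cite: Moonen1999MTNotes, (1.13)] [cite: Imai1976HodgeGroups, §1 (p. 367)] -/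
theorem hodgeGroupC_prod_eq_iff_forall_blockDiagC_mem :
    hodgeGroupC (prodPeriod Φ₁ Φ₂) = ((hodgeGroupC Φ₁).prod (hodgeGroupC Φ₂)).map (blockDiagC ι₁ ι₂) ↔
      ∀ N₁ ∈ hodgeGroupC Φ₁, ∀ N₂ ∈ hodgeGroupC Φ₂, blockDiagC ι₁ ι₂ (N₁, N₂) ∈ hodgeGroupC (prodPeriod Φ₁ Φ₂) := by
  constructor
  · intro h N₁ hN₁ N₂ hN₂
    rw [h]
    exact ⟨(N₁, N₂), Subgroup.mem_prod.2 ⟨hN₁, hN₂⟩, rfl⟩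
  · intro h
    refine le_antisymm (hodgeGroupC_prod_le_map_blockDiagC Φ₁ Φ₂) ?_
    rintro _ ⟨⟨N₁, N₂⟩, hN, rfl⟩
    exact h N₁ (Subgroup.mem_prod.1 hN).1 N₂ (Subgroup.mem_prod.1 hN).2

/-- `M̃T(X₁ × X₂)(ℂ) = M̃T(X₁)(ℂ) ×_{ℂ^×} M̃T(X₂)(ℂ)` iff every point of the fibre product lies in `M̃T(X₁ × X₂)(ℂ)`.
[cite: Moonen1999MTNotes, (1.13), (1.14)] -/
theorem extMumfordTateGroupC_prod_eq_iff_forall_extProdGL_mem :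
    extMumfordTateGroupC (prodPeriod Φ₁ Φ₂) = (extFiberProdC Φ₁ Φ₂).map (extProdGL ι₁ ι₂ ℂ) ↔
      ∀ x ∈ extFiberProdC Φ₁ Φ₂, extProdGL ι₁ ι₂ ℂ x ∈ extMumfordTateGroupC (prodPeriod Φ₁ Φ₂) := by
  constructor
  · intro h x hx
    rw [h]
    exact ⟨x, hx, rfl⟩
  · intro h
    refine le_antisymm (extMumfordTateGroupC_prod_le Φ₁ Φ₂) ?_
    rintro _ ⟨x, hx, rfl⟩
    exact h x hx

/-- `-N ∈ Hg(X)(ℂ)` for `N ∈ Hg(X)(ℂ)`: `-1 = h(e^{iπ}) ∈ Hg(X)`, realised as `h(e^{iπ}) · N`.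
[cite: Lange2023AbelianVarietiesComplex, §7.2.1 Remark 7.2.2 (1) and Prop. 7.1.1 ("`h(-1) = -1`")] -/
theorem exists_mem_hodgeGroupC_coe_eq_neg {ι : Type*} [Fintype ι] [DecidableEq ι] {E : Type*} [NormedAddCommGroup E]
    [NormedSpace ℂ E] (Φ : (ι → ℝ) ≃L[ℝ] E) {N : SpecialLinearGroup ι ℂ} (hN : N ∈ hodgeGroupC Φ) :
    ∃ N' ∈ hodgeGroupC Φ, (N' : Matrix ι ι ℂ) = -(N : Matrix ι ι ℂ) := by
  refine ⟨SpecialLinearGroup.map Complex.ofRealHom (hodgeCircleSL Φ π) * N,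
    (hodgeGroupC Φ).mul_mem (map_hodgeCircleSL_mem_hodgeGroupC Φ π) hN, ?_⟩
  rw [Matrix.SpecialLinearGroup.coe_mul, coe_map_hodgeCircleSL_pi, neg_mul, one_mul]

/-- Units of `ℂ` with equal squares agree up to sign. [folklore] -/
private theorem complexUnits_eq_or_eq_neg_of_sq_eq_sq {c₁ c₂ : ℂˣ} (h : c₁ ^ 2 = c₂ ^ 2) : c₂ = c₁ ∨ c₂ = -c₁ := by
  have h' : ((c₂ : ℂ)) ^ 2 = ((c₁ : ℂ)) ^ 2 := by
    have := congrArg (fun u : ℂˣ ↦ (u : ℂ)) h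
    simpa using this.symm
  rcases sq_eq_sq_iff_eq_or_eq_neg.1 h' with h1 | h1
  · exact Or.inl (Units.ext h1)
  · exact Or.inr (Units.ext (by rw [h1, Units.val_neg]))

/-- `(α · 1) · M = α • M` in `GL`. [folklore] -/
private theorem coe_scalar_mul' {ι : Type*} [Fintype ι] [DecidableEq ι] {R : Type*} [CommRing R] (α : Rˣ)
    (M : GL ι R) : ((Matrix.GeneralLinearGroup.scalar ι α * M : GL ι R) : Matrix ι ι R) = (α : R) • (M : Matrix ι ι R) := by
  rw [Units.val_mul, Matrix.GeneralLinearGroup.coe_scalar, Matrix.scalar_apply, ← Matrix.smul_one_eq_diagonal,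
    Matrix.smul_mul, Matrix.one_mul]

/-- **If `Hg(X₁ × X₂)(ℂ) = Hg(X₁)(ℂ) × Hg(X₂)(ℂ)` then `M̃T(X₁ × X₂)(ℂ) = M̃T(X₁)(ℂ) ×_{ℂ^×} M̃T(X₂)(ℂ)`** — equality in
Moonen's (1.13) for `M̃T` — for complex tori `X₁`, `X₂` carrying rational `(1,1)`-classes `η₁`, `η₂` with nonzero Gram
matrices (e.g. polarised abelian varieties). Mechanism: `M̃T(Xᵢ)(ℂ) = {(c · N, c²) : N ∈ Hg(Xᵢ)(ℂ)}` (Q994 §5), so a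
point of the fibre product is `((c N₁, ± c N₂), c²)`, and `(c · (N₁, ±N₂), c²) ∈ M̃T(X₁ × X₂)(ℂ)` (Q994 §6) because
`(N₁, ±N₂) ∈ Hg(X₁ × X₂)(ℂ)` (`-1 = h₂(e^{iπ})`). [cite: Moonen1999MTNotes, (1.13) ("the central factor `𝔾_m` … is counted twice in `MT(V₁) × MT(V₂)`") and (1.11) ("`MT(V)` is the almost direct product … of `𝔾_{m,ℚ}` and `Hg(V)`")]
[cite: Moonen2004MT, §4 Lemma 4.6, (4.7) and §5 (5.2)] -/
theorem extProdGL_mem_extMumfordTateGroupC_prod_of_forall_blockDiagC_mem {η₁ : E₁ [⋀^Fin 2]→L[ℝ] ℝ}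
    {η₂ : E₂ [⋀^Fin 2]→L[ℝ] ℝ} (h₁ : ∀ u v : E₁, η₁ ![I • u, I • v] = η₁ ![u, v])
    (hG₁ : ∃ G₀ : Matrix ι₁ ι₁ ℚ, G₀.map (Rat.cast : ℚ → ℝ) = latticeGram Φ₁ η₁) (hG₁0 : latticeGram Φ₁ η₁ ≠ 0)
    (h₂ : ∀ u v : E₂, η₂ ![I • u, I • v] = η₂ ![u, v])
    (hG₂ : ∃ G₀ : Matrix ι₂ ι₂ ℚ, G₀.map (Rat.cast : ℚ → ℝ) = latticeGram Φ₂ η₂) (hG₂0 : latticeGram Φ₂ η₂ ≠ 0)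
    (hHg : ∀ N₁ ∈ hodgeGroupC Φ₁, ∀ N₂ ∈ hodgeGroupC Φ₂, blockDiagC ι₁ ι₂ (N₁, N₂) ∈ hodgeGroupC (prodPeriod Φ₁ Φ₂))
    {x : (GL ι₁ ℂ × GL ι₂ ℂ) × ℂˣ} (hx : x ∈ extFiberProdC Φ₁ Φ₂) :
    extProdGL ι₁ ι₂ ℂ x ∈ extMumfordTateGroupC (prodPeriod Φ₁ Φ₂) := by
  obtain ⟨⟨g₁, g₂⟩, c⟩ := x
  have hx₁ : extGL ι₁ ℂ (g₁, c) ∈ extMumfordTateGroupC Φ₁ := ((mem_extFiberProdC_iff Φ₁ Φ₂).1 hx).1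
  have hx₂ : extGL ι₂ ℂ (g₂, c) ∈ extMumfordTateGroupC Φ₂ := ((mem_extFiberProdC_iff Φ₁ Φ₂).1 hx).2
  obtain ⟨c₁, N₁, hN₁, he₁⟩ := (mem_extMumfordTateGroupC_iff_exists_hodgeGroupC h₁ hG₁ hG₁0).1 hx₁
  obtain ⟨c₂, N₂, hN₂, he₂⟩ := (mem_extMumfordTateGroupC_iff_exists_hodgeGroupC h₂ hG₂ hG₂0).1 hx₂
  obtain ⟨hg₁, hc₁⟩ := Prod.mk.inj (extGL_injective ι₁ ℂ he₁)
  obtain ⟨hg₂, hc₂⟩ := Prod.mk.inj (extGL_injective ι₂ ℂ he₂)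
  -- the two square roots of `c` agree up to sign; absorb the sign into `N₂`
  have hsq : c₁ ^ 2 = c₂ ^ 2 := by rw [← hc₁, ← hc₂]
  obtain ⟨N₂', hN₂', hg₂'⟩ : ∃ N₂' ∈ hodgeGroupC Φ₂,
      g₂ = Matrix.GeneralLinearGroup.scalar ι₂ c₁ * Matrix.SpecialLinearGroup.toGL N₂' := by
    rcases complexUnits_eq_or_eq_neg_of_sq_eq_sq hsq with h | h
    · exact ⟨N₂, hN₂, by rw [hg₂, h]⟩
    · obtain ⟨N₂', hN₂', hneg⟩ := exists_mem_hodgeGroupC_coe_eq_neg Φ₂ hN₂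
      refine ⟨N₂', hN₂', Units.ext ?_⟩
      rw [hg₂, coe_scalar_mul', coe_scalar_mul', h, Units.val_neg, neg_smul, ← smul_neg,
        Matrix.SpecialLinearGroup.coe_GL_coe_matrix, Matrix.SpecialLinearGroup.coe_GL_coe_matrix, hneg]
  have hmem := extGL_scalar_mul_toGL_mem_extMumfordTateGroupC (prodPeriod Φ₁ Φ₂) c₁ (hHg N₁ hN₁ N₂' hN₂')
  rw [toGL_blockDiagC, scalar_mul_blockDiagGL, ← hg₁, ← hg₂', ← hc₁] at hmem
  exact hmem

/-- The Gram matrix of `η₁ ⊞ η₂` is nonzero when that of `η₁` is. [cite: Lange2023AbelianVarietiesComplex, Cor. 2.4.24] -/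
theorem latticeGram_prodForm_ne_zero_of_left {η₁ : E₁ [⋀^Fin 2]→L[ℝ] ℝ} {η₂ : E₂ [⋀^Fin 2]→L[ℝ] ℝ}
    (hG₁0 : latticeGram Φ₁ η₁ ≠ 0) : latticeGram (prodPeriod Φ₁ Φ₂) (prodForm η₁ η₂) ≠ 0 := by
  rw [latticeGram_prod]
  intro h
  rw [← Matrix.fromBlocks_zero, Matrix.fromBlocks_inj] at h
  exact hG₁0 h.1

/-- The Gram matrix of `η₁ ⊞ η₂` is nonzero when that of `η₂` is. [cite: Lange2023AbelianVarietiesComplex, Cor. 2.4.24] -/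
theorem latticeGram_prodForm_ne_zero_of_right {η₁ : E₁ [⋀^Fin 2]→L[ℝ] ℝ} {η₂ : E₂ [⋀^Fin 2]→L[ℝ] ℝ}
    (hG₂0 : latticeGram Φ₂ η₂ ≠ 0) : latticeGram (prodPeriod Φ₁ Φ₂) (prodForm η₁ η₂) ≠ 0 := by
  rw [latticeGram_prod]
  intro h
  rw [← Matrix.fromBlocks_zero, Matrix.fromBlocks_inj] at h
  exact hG₂0 h.2.2.2

/-- **Conversely, if `M̃T(X₁ × X₂)(ℂ) = M̃T(X₁)(ℂ) ×_{ℂ^×} M̃T(X₂)(ℂ)` then `Hg(X₁ × X₂)(ℂ) = Hg(X₁)(ℂ) × Hg(X₂)(ℂ)`**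
(same hypotheses): `(Nᵢ, 1) ∈ M̃T(Xᵢ)(ℂ)` (Q994 §6), so `((N₁, N₂), 1) ∈ M̃T(X₁ × X₂)(ℂ)`, and `(N, 1) ∈ M̃T(X₁ × X₂)(ℂ)`
forces `N ∈ Hg(X₁ × X₂)(ℂ)` (Deligne's `G⁰ = Ker(G → 𝔾_m) = Hg`, Q994 §8, for the product class `η₁ ⊞ η₂`).
[cite: Moonen1999MTNotes, (1.13), (1.14)] [cite: Deligne1982HodgeCycles, I §3, proof of Prop. 3.6 ("`G⁰ = Ker(G → G_m)`")]
[cite: Moonen2004MT, §5 (5.8) ("`Hg(X) := Ker(MT(X) → G_m)`")] -/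
theorem blockDiagC_mem_hodgeGroupC_prod_of_forall_extProdGL_mem {η₁ : E₁ [⋀^Fin 2]→L[ℝ] ℝ}
    {η₂ : E₂ [⋀^Fin 2]→L[ℝ] ℝ} (h₁ : ∀ u v : E₁, η₁ ![I • u, I • v] = η₁ ![u, v])
    (hG₁ : ∃ G₀ : Matrix ι₁ ι₁ ℚ, G₀.map (Rat.cast : ℚ → ℝ) = latticeGram Φ₁ η₁) (hG₁0 : latticeGram Φ₁ η₁ ≠ 0)
    (h₂ : ∀ u v : E₂, η₂ ![I • u, I • v] = η₂ ![u, v])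
    (hG₂ : ∃ G₀ : Matrix ι₂ ι₂ ℚ, G₀.map (Rat.cast : ℚ → ℝ) = latticeGram Φ₂ η₂)
    (hMT : ∀ x ∈ extFiberProdC Φ₁ Φ₂, extProdGL ι₁ ι₂ ℂ x ∈ extMumfordTateGroupC (prodPeriod Φ₁ Φ₂))
    {N₁ : SpecialLinearGroup ι₁ ℂ} (hN₁ : N₁ ∈ hodgeGroupC Φ₁) {N₂ : SpecialLinearGroup ι₂ ℂ}
    (hN₂ : N₂ ∈ hodgeGroupC Φ₂) : blockDiagC ι₁ ι₂ (N₁, N₂) ∈ hodgeGroupC (prodPeriod Φ₁ Φ₂) := by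
  have hx : ((Matrix.SpecialLinearGroup.toGL N₁, Matrix.SpecialLinearGroup.toGL N₂), (1 : ℂˣ)) ∈ extFiberProdC Φ₁ Φ₂ :=
    (mem_extFiberProdC_iff Φ₁ Φ₂).2
      ⟨extGL_toGL_one_mem_extMumfordTateGroupC Φ₁ hN₁, extGL_toGL_one_mem_extMumfordTateGroupC Φ₂ hN₂⟩
  have hmem := hMT _ hx
  rw [extProdGL_apply, ← toGL_blockDiagC] at hmem
  exact (extGL_toGL_one_mem_extMumfordTateGroupC_iff (prodPeriod Φ₁ Φ₂) (prodForm_I_smul h₁ h₂)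
    (exists_ratMatrix_latticeGram_prodForm hG₁ hG₂) (latticeGram_prodForm_ne_zero_of_left Φ₁ Φ₂ hG₁0)).1 hmem

/-- **THE CRITERION.** For complex tori `X₁`, `X₂` carrying rational `(1,1)`-classes with nonzero Gram matrices
(e.g. polarised abelian varieties), on complex points:
**`M̃T(X₁ × X₂)(ℂ) = M̃T(X₁)(ℂ) ×_{ℂ^×} M̃T(X₂)(ℂ) ⟺ Hg(X₁ × X₂)(ℂ) = Hg(X₁)(ℂ) × Hg(X₂)(ℂ)`** — Moonen's (1.13)
inclusion for `M̃T` (the tree's `extMumfordTateGroup_prod_le`, complex points `extMumfordTateGroupC_prod_le`) is an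
equality exactly when the one for `Hg` is: in `GL(V₁) × GL(V₂) × 𝔾_m` the central factor is counted once, so the only
defect left is that of the Hodge groups. [cite: Moonen1999MTNotes, (1.13) and (1.14)] [cite: Moonen2004MT, §4 Lemma 4.6, (4.7); §5 (5.2), (5.8)] -/
theorem extMumfordTateGroupC_prod_eq_iff_hodgeGroupC_prod_eq {η₁ : E₁ [⋀^Fin 2]→L[ℝ] ℝ} {η₂ : E₂ [⋀^Fin 2]→L[ℝ] ℝ}
    (h₁ : ∀ u v : E₁, η₁ ![I • u, I • v] = η₁ ![u, v])
    (hG₁ : ∃ G₀ : Matrix ι₁ ι₁ ℚ, G₀.map (Rat.cast : ℚ → ℝ) = latticeGram Φ₁ η₁) (hG₁0 : latticeGram Φ₁ η₁ ≠ 0)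
    (h₂ : ∀ u v : E₂, η₂ ![I • u, I • v] = η₂ ![u, v])
    (hG₂ : ∃ G₀ : Matrix ι₂ ι₂ ℚ, G₀.map (Rat.cast : ℚ → ℝ) = latticeGram Φ₂ η₂) (hG₂0 : latticeGram Φ₂ η₂ ≠ 0) :
    extMumfordTateGroupC (prodPeriod Φ₁ Φ₂) = (extFiberProdC Φ₁ Φ₂).map (extProdGL ι₁ ι₂ ℂ) ↔
      hodgeGroupC (prodPeriod Φ₁ Φ₂) = ((hodgeGroupC Φ₁).prod (hodgeGroupC Φ₂)).map (blockDiagC ι₁ ι₂) := by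
  rw [extMumfordTateGroupC_prod_eq_iff_forall_extProdGL_mem, hodgeGroupC_prod_eq_iff_forall_blockDiagC_mem]
  exact ⟨fun h N₁ hN₁ N₂ hN₂ ↦ blockDiagC_mem_hodgeGroupC_prod_of_forall_extProdGL_mem Φ₁ Φ₂ h₁ hG₁ hG₁0 h₂ hG₂ h hN₁ hN₂,
    fun h x hx ↦ extProdGL_mem_extMumfordTateGroupC_prod_of_forall_blockDiagC_mem Φ₁ Φ₂ h₁ hG₁ hG₁0 h₂ hG₂ hG₂0 h hx⟩

/-- **Polarised abelian varieties: `M̃T(X₁ × X₂)(ℂ) = M̃T(X₁)(ℂ) ×_{ℂ^×} M̃T(X₂)(ℂ) ⟺ Hg(X₁ × X₂)(ℂ) = Hg(X₁)(ℂ) × Hg(X₂)(ℂ)`.**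
[cite: Moonen1999MTNotes, (1.13), (1.14)] [cite: Moonen2004MT, §5 (5.2), (5.8)] -/
theorem IsRiemannForm.extMumfordTateGroupC_prod_eq_iff_hodgeGroupC_prod_eq [Nonempty ι₁] [Nonempty ι₂]
    {η₁ : E₁ [⋀^Fin 2]→L[ℝ] ℝ} {η₂ : E₂ [⋀^Fin 2]→L[ℝ] ℝ} (hη₁ : IsRiemannForm Φ₁ η₁) (hη₂ : IsRiemannForm Φ₂ η₂) :
    extMumfordTateGroupC (prodPeriod Φ₁ Φ₂) = (extFiberProdC Φ₁ Φ₂).map (extProdGL ι₁ ι₂ ℂ) ↔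
      hodgeGroupC (prodPeriod Φ₁ Φ₂) = ((hodgeGroupC Φ₁).prod (hodgeGroupC Φ₂)).map (blockDiagC ι₁ ι₂) :=
  ComplexTorus.extMumfordTateGroupC_prod_eq_iff_hodgeGroupC_prod_eq Φ₁ Φ₂ hη₁.1 hη₁.exists_ratMatrix_latticeGram
    hη₁.latticeGram_ne_zero hη₂.1 hη₂.exists_ratMatrix_latticeGram hη₂.latticeGram_ne_zero

/-- `G ⊗ 1 ≠ 0` for `G ≠ 0`. [folklore] -/
private theorem map_ofRealHom_ne_zero' {ι : Type*} {G : Matrix ι ι ℝ} (hG : G ≠ 0) : G.map Complex.ofRealHom ≠ 0 := by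
  intro h
  apply hG
  ext i j
  have hij := congrFun (congrFun h i) j
  simpa using hij

/-- **`(A 0; 0 B) ∈ MT(X₁ × X₂)(ℂ) ⟹ (A, c) ∈ M̃T(X₁)(ℂ)` and `(B, c) ∈ M̃T(X₂)(ℂ)` for a COMMON `c ∈ ℂ^×`** — the
multiplier of `(A 0; 0 B)` on `η₁ ⊞ η₂` (Gordon's Lemma 2.7 on the product, Q994 §5, then the restrictions of the
tree's functoriality file); all complex tori with rational `(1,1)`-classes, `G₁ ≠ 0`.
[cite: Moonen2004MT, §4 Lemma 4.6, (4.7); §5 (5.2)] [cite: Gordon1997, Lemma 2.7] -/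
theorem exists_extGL_mem_of_blockDiagGL_mem_mumfordTateGroupC_prod {η₁ : E₁ [⋀^Fin 2]→L[ℝ] ℝ}
    {η₂ : E₂ [⋀^Fin 2]→L[ℝ] ℝ} (h₁ : ∀ u v : E₁, η₁ ![I • u, I • v] = η₁ ![u, v])
    (hG₁ : ∃ G₀ : Matrix ι₁ ι₁ ℚ, G₀.map (Rat.cast : ℚ → ℝ) = latticeGram Φ₁ η₁) (hG₁0 : latticeGram Φ₁ η₁ ≠ 0)
    (h₂ : ∀ u v : E₂, η₂ ![I • u, I • v] = η₂ ![u, v])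
    (hG₂ : ∃ G₀ : Matrix ι₂ ι₂ ℚ, G₀.map (Rat.cast : ℚ → ℝ) = latticeGram Φ₂ η₂) {A : GL ι₁ ℂ} {B : GL ι₂ ℂ}
    (h : blockDiagGL ι₁ ι₂ ℂ (A, B) ∈ mumfordTateGroupC (prodPeriod Φ₁ Φ₂)) :
    ∃ c : ℂˣ, extGL ι₁ ℂ (A, c) ∈ extMumfordTateGroupC Φ₁ ∧ extGL ι₂ ℂ (B, c) ∈ extMumfordTateGroupC Φ₂ := by
  have hG0 := latticeGram_prodForm_ne_zero_of_left Φ₁ Φ₂ (η₂ := η₂) hG₁0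
  obtain ⟨μ, hμ⟩ := exists_transpose_mul_latticeGram_mul_eq_smul_of_mem_mumfordTateGroupC (prodForm_I_smul h₁ h₂)
    (exists_ratMatrix_latticeGram_prodForm hG₁ hG₂) h
  have hμ0 : μ ≠ 0 :=
    multiplier_ne_zero ((Matrix.isUnit_iff_isUnit_det _).1 (Units.isUnit _)) (map_ofRealHom_ne_zero' hG0) hμ
  have hmem := extGL_mem_extMumfordTateGroupC_of_mem_mumfordTateGroupC (prodForm_I_smul h₁ h₂)
    (exists_ratMatrix_latticeGram_prodForm hG₁ hG₂) hG0 h (c := Units.mk0 μ hμ0) hμ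
  exact ⟨Units.mk0 μ hμ0, extGL_fst_mem_extMumfordTateGroupC_of_mem_prod Φ₁ Φ₂ hmem,
    extGL_snd_mem_extMumfordTateGroupC_of_mem_prod Φ₁ Φ₂ hmem⟩

/-- **`MT(X₁ × X₂)(ℂ)` against the fibre product, complex points.** For `X₁`, `X₂` with rational `(1,1)`-classes
whose Gram matrices are nonzero: `(A 0; 0 B) ∈ MT(X₁ × X₂)(ℂ)` always forces `(A, c) ∈ M̃T(X₁)(ℂ)` and
`(B, c) ∈ M̃T(X₂)(ℂ)` for a COMMON `c ∈ ℂ^×`, and when `Hg(X₁ × X₂)(ℂ) = Hg(X₁)(ℂ) × Hg(X₂)(ℂ)` the converse holds: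
**`(A 0; 0 B) ∈ MT(X₁ × X₂)(ℂ) ⟺ ∃ c, (A, c) ∈ M̃T(X₁)(ℂ) and (B, c) ∈ M̃T(X₂)(ℂ)`**, i.e.
`MT(X₁ × X₂) = MT(X₁) ×_{𝔾_m} MT(X₂)` over the multiplier characters `νᵢ : MT(Xᵢ) → 𝔾_m` (Moonen's "`MT(V)` is the
almost direct product of `𝔾_m` and `Hg(V)`" for the product). [cite: Moonen1999MTNotes, (1.11), (1.13), (1.14)]
[cite: Moonen2004MT, §4 Lemma 4.6, (4.7); §5 (5.2)] -/
theorem blockDiagGL_mem_mumfordTateGroupC_prod_iff_of_forall_blockDiagC_mem {η₁ : E₁ [⋀^Fin 2]→L[ℝ] ℝ}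
    {η₂ : E₂ [⋀^Fin 2]→L[ℝ] ℝ} (h₁ : ∀ u v : E₁, η₁ ![I • u, I • v] = η₁ ![u, v])
    (hG₁ : ∃ G₀ : Matrix ι₁ ι₁ ℚ, G₀.map (Rat.cast : ℚ → ℝ) = latticeGram Φ₁ η₁) (hG₁0 : latticeGram Φ₁ η₁ ≠ 0)
    (h₂ : ∀ u v : E₂, η₂ ![I • u, I • v] = η₂ ![u, v])
    (hG₂ : ∃ G₀ : Matrix ι₂ ι₂ ℚ, G₀.map (Rat.cast : ℚ → ℝ) = latticeGram Φ₂ η₂) (hG₂0 : latticeGram Φ₂ η₂ ≠ 0)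
    (hHg : ∀ N₁ ∈ hodgeGroupC Φ₁, ∀ N₂ ∈ hodgeGroupC Φ₂, blockDiagC ι₁ ι₂ (N₁, N₂) ∈ hodgeGroupC (prodPeriod Φ₁ Φ₂))
    {A : GL ι₁ ℂ} {B : GL ι₂ ℂ} :
    blockDiagGL ι₁ ι₂ ℂ (A, B) ∈ mumfordTateGroupC (prodPeriod Φ₁ Φ₂) ↔
      ∃ c : ℂˣ, extGL ι₁ ℂ (A, c) ∈ extMumfordTateGroupC Φ₁ ∧ extGL ι₂ ℂ (B, c) ∈ extMumfordTateGroupC Φ₂ := by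
  refine ⟨fun h ↦ ?_, fun ⟨c, hA, hB⟩ ↦ ?_⟩
  · exact exists_extGL_mem_of_blockDiagGL_mem_mumfordTateGroupC_prod Φ₁ Φ₂ h₁ hG₁ hG₁0 h₂ hG₂ h
  · exact fst_mem_mumfordTateGroupC_of_extGL_mem (prodPeriod Φ₁ Φ₂)
      (extProdGL_mem_extMumfordTateGroupC_prod_of_forall_blockDiagC_mem Φ₁ Φ₂ h₁ hG₁ hG₁0 h₂ hG₂ hG₂0 hHg
        (x := ((A, B), c)) ((mem_extFiberProdC_iff Φ₁ Φ₂).2 ⟨hA, hB⟩))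

/-- **Real points: `Hg(X₁ × X₂)(ℂ) = Hg(X₁)(ℂ) × Hg(X₂)(ℂ) ⟹ M̃T(X₁ × X₂)(ℝ) = M̃T(X₁)(ℝ) ×_{ℝ^×} M̃T(X₂)(ℝ)`** — every
point of the real fibre product lies in `M̃T(X₁ × X₂)(ℝ)` (through `GL(ℝ) → GL(ℂ)` and the complex-points theorem).
[cite: Moonen1999MTNotes, (1.13), (1.14)] [cite: Moonen2004MT, §4 Lemma 4.6, (4.7); §5 (5.2)] -/
theorem extProdGL_mem_extMumfordTateGroup_prod_of_forall_blockDiagC_mem {η₁ : E₁ [⋀^Fin 2]→L[ℝ] ℝ}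
    {η₂ : E₂ [⋀^Fin 2]→L[ℝ] ℝ} (h₁ : ∀ u v : E₁, η₁ ![I • u, I • v] = η₁ ![u, v])
    (hG₁ : ∃ G₀ : Matrix ι₁ ι₁ ℚ, G₀.map (Rat.cast : ℚ → ℝ) = latticeGram Φ₁ η₁) (hG₁0 : latticeGram Φ₁ η₁ ≠ 0)
    (h₂ : ∀ u v : E₂, η₂ ![I • u, I • v] = η₂ ![u, v])
    (hG₂ : ∃ G₀ : Matrix ι₂ ι₂ ℚ, G₀.map (Rat.cast : ℚ → ℝ) = latticeGram Φ₂ η₂) (hG₂0 : latticeGram Φ₂ η₂ ≠ 0)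
    (hHg : ∀ N₁ ∈ hodgeGroupC Φ₁, ∀ N₂ ∈ hodgeGroupC Φ₂, blockDiagC ι₁ ι₂ (N₁, N₂) ∈ hodgeGroupC (prodPeriod Φ₁ Φ₂))
    {x : (GL ι₁ ℝ × GL ι₂ ℝ) × ℝˣ} (hx : x ∈ extFiberProd Φ₁ Φ₂) :
    extProdGL ι₁ ι₂ ℝ x ∈ extMumfordTateGroup (prodPeriod Φ₁ Φ₂) := by
  obtain ⟨⟨A, B⟩, t⟩ := x
  have hA : extGL ι₁ ℝ (A, t) ∈ extMumfordTateGroup Φ₁ := ((mem_extFiberProd_iff Φ₁ Φ₂).1 hx).1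
  have hB : extGL ι₂ ℝ (B, t) ∈ extMumfordTateGroup Φ₂ := ((mem_extFiberProd_iff Φ₁ Φ₂).1 hx).2
  rw [← map_ofRealHom_mem_extMumfordTateGroupC_iff, map_extGL] at hA hB
  rw [extProdGL_apply, ← map_ofRealHom_mem_extMumfordTateGroupC_iff, map_extGL, map_blockDiagGL]
  exact extProdGL_mem_extMumfordTateGroupC_prod_of_forall_blockDiagC_mem Φ₁ Φ₂ h₁ hG₁ hG₁0 h₂ hG₂ hG₂0 hHg
    (x := ((Matrix.GeneralLinearGroup.map Complex.ofRealHom A, Matrix.GeneralLinearGroup.map Complex.ofRealHom B),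
      Units.map (Complex.ofRealHom : ℝ →* ℂ) t)) ((mem_extFiberProdC_iff Φ₁ Φ₂).2 ⟨hA, hB⟩)

/-- **`Hg(X₁ × X₂)(ℂ) = Hg(X₁)(ℂ) × Hg(X₂)(ℂ) ⟹ M̃T(X₁ × X₂)(ℝ) = M̃T(X₁)(ℝ) ×_{ℝ^×} M̃T(X₂)(ℝ)`** (equality in the
tree's `extMumfordTateGroup_prod_le`, real points). [cite: Moonen1999MTNotes, (1.13), (1.14)] [cite: Moonen2004MT, §4 Lemma 4.6, (4.7); §5 (5.2)] -/
theorem extMumfordTateGroup_prod_eq_of_hodgeGroupC_prod_eq {η₁ : E₁ [⋀^Fin 2]→L[ℝ] ℝ} {η₂ : E₂ [⋀^Fin 2]→L[ℝ] ℝ}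
    (h₁ : ∀ u v : E₁, η₁ ![I • u, I • v] = η₁ ![u, v])
    (hG₁ : ∃ G₀ : Matrix ι₁ ι₁ ℚ, G₀.map (Rat.cast : ℚ → ℝ) = latticeGram Φ₁ η₁) (hG₁0 : latticeGram Φ₁ η₁ ≠ 0)
    (h₂ : ∀ u v : E₂, η₂ ![I • u, I • v] = η₂ ![u, v])
    (hG₂ : ∃ G₀ : Matrix ι₂ ι₂ ℚ, G₀.map (Rat.cast : ℚ → ℝ) = latticeGram Φ₂ η₂) (hG₂0 : latticeGram Φ₂ η₂ ≠ 0)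
    (hHg : hodgeGroupC (prodPeriod Φ₁ Φ₂) = ((hodgeGroupC Φ₁).prod (hodgeGroupC Φ₂)).map (blockDiagC ι₁ ι₂)) :
    extMumfordTateGroup (prodPeriod Φ₁ Φ₂) = (extFiberProd Φ₁ Φ₂).map (extProdGL ι₁ ι₂ ℝ) := by
  refine le_antisymm (extMumfordTateGroup_prod_le Φ₁ Φ₂) ?_
  rintro _ ⟨x, hx, rfl⟩
  exact extProdGL_mem_extMumfordTateGroup_prod_of_forall_blockDiagC_mem Φ₁ Φ₂ h₁ hG₁ hG₁0 h₂ hG₂ hG₂0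
    ((hodgeGroupC_prod_eq_iff_forall_blockDiagC_mem Φ₁ Φ₂).1 hHg) hx

/-- **Polarised abelian varieties: `Hg(X₁ × X₂)(ℂ) = Hg(X₁)(ℂ) × Hg(X₂)(ℂ) ⟹ M̃T(X₁ × X₂)(ℝ) = M̃T(X₁)(ℝ) ×_{ℝ^×} M̃T(X₂)(ℝ)`.**
[cite: Moonen1999MTNotes, (1.13), (1.14)] [cite: Moonen2004MT, §5 (5.2), (5.8)] -/
theorem IsRiemannForm.extMumfordTateGroup_prod_eq_of_hodgeGroupC_prod_eq [Nonempty ι₁] [Nonempty ι₂]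
    {η₁ : E₁ [⋀^Fin 2]→L[ℝ] ℝ} {η₂ : E₂ [⋀^Fin 2]→L[ℝ] ℝ} (hη₁ : IsRiemannForm Φ₁ η₁) (hη₂ : IsRiemannForm Φ₂ η₂)
    (hHg : hodgeGroupC (prodPeriod Φ₁ Φ₂) = ((hodgeGroupC Φ₁).prod (hodgeGroupC Φ₂)).map (blockDiagC ι₁ ι₂)) :
    extMumfordTateGroup (prodPeriod Φ₁ Φ₂) = (extFiberProd Φ₁ Φ₂).map (extProdGL ι₁ ι₂ ℝ) :=
  ComplexTorus.extMumfordTateGroup_prod_eq_of_hodgeGroupC_prod_eq Φ₁ Φ₂ hη₁.1 hη₁.exists_ratMatrix_latticeGram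
    hη₁.latticeGram_ne_zero hη₂.1 hη₂.exists_ratMatrix_latticeGram hη₂.latticeGram_ne_zero hHg

/-- **Real points, `MT` level: under `Hg(X₁ × X₂)(ℂ) = Hg(X₁)(ℂ) × Hg(X₂)(ℂ)`,
`(A 0; 0 B) ∈ MT(X₁ × X₂)(ℝ) ⟺ ∃ t ∈ ℝ^×, (A, t) ∈ M̃T(X₁)(ℝ) and (B, t) ∈ M̃T(X₂)(ℝ)`** — `MT(X₁ × X₂)(ℝ)` is the
fibre product of `MT(X₁)(ℝ)` and `MT(X₂)(ℝ)` over the multipliers (`⟹` holds for all tori: Gordon's Lemma 2.7 on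
`η₁ ⊞ η₂`, the tree's `exists_common_multiplier_of_blockDiagGL_mem_mumfordTateGroup_prod`).
[cite: Moonen1999MTNotes, (1.11), (1.13), (1.14)] [cite: Moonen2004MT, §4 Lemma 4.6, (4.7); §5 (5.2)] [cite: Gordon1997, Lemma 2.7] -/
theorem blockDiagGL_mem_mumfordTateGroup_prod_iff_of_forall_blockDiagC_mem {η₁ : E₁ [⋀^Fin 2]→L[ℝ] ℝ}
    {η₂ : E₂ [⋀^Fin 2]→L[ℝ] ℝ} (h₁ : ∀ u v : E₁, η₁ ![I • u, I • v] = η₁ ![u, v])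
    (hG₁ : ∃ G₀ : Matrix ι₁ ι₁ ℚ, G₀.map (Rat.cast : ℚ → ℝ) = latticeGram Φ₁ η₁) (hG₁0 : latticeGram Φ₁ η₁ ≠ 0)
    (h₂ : ∀ u v : E₂, η₂ ![I • u, I • v] = η₂ ![u, v])
    (hG₂ : ∃ G₀ : Matrix ι₂ ι₂ ℚ, G₀.map (Rat.cast : ℚ → ℝ) = latticeGram Φ₂ η₂) (hG₂0 : latticeGram Φ₂ η₂ ≠ 0)
    (hHg : ∀ N₁ ∈ hodgeGroupC Φ₁, ∀ N₂ ∈ hodgeGroupC Φ₂, blockDiagC ι₁ ι₂ (N₁, N₂) ∈ hodgeGroupC (prodPeriod Φ₁ Φ₂))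
    {A : GL ι₁ ℝ} {B : GL ι₂ ℝ} :
    blockDiagGL ι₁ ι₂ ℝ (A, B) ∈ mumfordTateGroup (prodPeriod Φ₁ Φ₂) ↔
      ∃ t : ℝˣ, extGL ι₁ ℝ (A, t) ∈ extMumfordTateGroup Φ₁ ∧ extGL ι₂ ℝ (B, t) ∈ extMumfordTateGroup Φ₂ := by
  refine ⟨fun h ↦ ?_, fun ⟨t, hA, hB⟩ ↦ ?_⟩
  · obtain ⟨ν, hνA, hνB⟩ := exists_common_multiplier_of_blockDiagGL_mem_mumfordTateGroup_prod h₁ hG₁ h₂ hG₂ h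
    have hν0 : ν ≠ 0 :=
      multiplier_ne_zero ((Matrix.isUnit_iff_isUnit_det _).1 (Units.isUnit A)) hG₁0 hνA
    exact ⟨Units.mk0 ν hν0,
      extGL_mem_extMumfordTateGroup_of_mem_mumfordTateGroup h₁ hG₁ hG₁0
        (fst_mem_mumfordTateGroup_of_blockDiagGL_mem Φ₁ Φ₂ h) hνA,
      extGL_mem_extMumfordTateGroup_of_mem_mumfordTateGroup h₂ hG₂ hG₂0
        (snd_mem_mumfordTateGroup_of_blockDiagGL_mem Φ₁ Φ₂ h) hνB⟩
  · exact fst_mem_mumfordTateGroup_of_extGL_mem (prodPeriod Φ₁ Φ₂)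
      (extProdGL_mem_extMumfordTateGroup_prod_of_forall_blockDiagC_mem Φ₁ Φ₂ h₁ hG₁ hG₁0 h₂ hG₂ hG₂0 hHg
        (x := ((A, B), t)) ((mem_extFiberProd_iff Φ₁ Φ₂).2 ⟨hA, hB⟩))

end Criterion

/-! ## §2 Strictness: a nonzero Hodge class in `Hom(V₁, V₂)` makes the inclusions proper -/

section Strict

variable {ι₁ ι₂ : Type*} [Fintype ι₁] [Fintype ι₂] [DecidableEq ι₁] [DecidableEq ι₂]
  {E₁ E₂ : Type*} [NormedAddCommGroup E₁] [NormedSpace ℂ E₁] [NormedAddCommGroup E₂] [NormedSpace ℂ E₂]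
  (Φ₁ : (ι₁ → ℝ) ≃L[ℝ] E₁) (Φ₂ : (ι₂ → ℝ) ≃L[ℝ] E₂)

/-- **`(1, −1) ∉ MT(X₁ × X₂)(ℂ)` as soon as `Hom_ℚ(X₁, X₂) ≠ 0`** (complex tori of any dimensions; Moonen's hint
"a non-zero Hodge class in `Hom(V₁, V₂)`"): if `(1 0; 0 −1) = α · (N₁ 0; 0 N₂)` with `(N₁ 0; 0 N₂) ∈ Hg(X₁ × X₂)(ℂ)`,
the graph relation `N₂ B = B N₁` of the tree's `snd_mul_eq_mul_fst_of_blockDiagC_mem_hodgeGroupC_prod` (Imai: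
"`Hg(E₁ × E₂) = {(x, λxλ⁻¹)}`") gives `−B = B`, so `B = 0`. [cite: Moonen2004MT, §5 (5.6) Exercise, Hint (p. 12)]
[cite: Imai1976HodgeGroups, §3 Remarks (p. 370)] -/
theorem blockDiagGL_one_neg_one_not_mem_mumfordTateGroupC_prod {B : Matrix ι₂ ι₁ ℚ} (hB : B ∈ homRat Φ₁ Φ₂)
    (hB0 : B ≠ 0) : blockDiagGL ι₁ ι₂ ℂ (1, -1) ∉ mumfordTateGroupC (prodPeriod Φ₁ Φ₂) := by
  intro h
  obtain ⟨α, N, hN, he⟩ := (mem_mumfordTateGroupC_iff_exists_eq_scalar_mul _).1 h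
  obtain ⟨N₁, -, N₂, -, rfl⟩ := exists_eq_blockDiagC_of_mem_hodgeGroupC_prod Φ₁ Φ₂ hN
  have hgraph := snd_mul_eq_mul_fst_of_blockDiagC_mem_hodgeGroupC_prod Φ₁ Φ₂ hB hN
  have hmat := congrArg (fun g : GL (ι₁ ⊕ ι₂) ℂ ↦ (g : Matrix (ι₁ ⊕ ι₂) (ι₁ ⊕ ι₂) ℂ)) he
  rw [coe_blockDiagGL, coe_scalar_mul', Matrix.SpecialLinearGroup.coe_GL_coe_matrix, coe_blockDiagC,
    Matrix.fromBlocks_smul, smul_zero, Units.val_one, Units.val_neg, Units.val_one] at hmat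
  -- `α N₁ = 1`, `α N₂ = -1`; the graph relation gives `-B = B`
  have h11 : (1 : Matrix ι₁ ι₁ ℂ) = (α : ℂ) • (N₁ : Matrix ι₁ ι₁ ℂ) := (Matrix.fromBlocks_inj.1 hmat).1
  have h22 : (-1 : Matrix ι₂ ι₂ ℂ) = (α : ℂ) • (N₂ : Matrix ι₂ ι₂ ℂ) := (Matrix.fromBlocks_inj.1 hmat).2.2.2
  have key : -(B.map (algebraMap ℚ ℂ)) = B.map (algebraMap ℚ ℂ) := by
    have e := congrArg (fun M : Matrix ι₂ ι₁ ℂ ↦ (α : ℂ) • M) hgraph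
    have e' : ((α : ℂ) • (N₂ : Matrix ι₂ ι₂ ℂ)) * B.map (algebraMap ℚ ℂ) =
        B.map (algebraMap ℚ ℂ) * ((α : ℂ) • (N₁ : Matrix ι₁ ι₁ ℂ)) := by
      rw [Matrix.smul_mul, Matrix.mul_smul]; exact e
    rwa [← h11, ← h22, Matrix.mul_one, Matrix.neg_mul, Matrix.one_mul] at e'
  have h2 : (2 : ℂ) • B.map (algebraMap ℚ ℂ) = 0 := by
    rw [two_smul]
    nth_rw 1 [← key]
    rw [neg_add_cancel]
  rcases smul_eq_zero.1 h2 with h0 | h0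
  · exact two_ne_zero h0
  · exact hB0 (Matrix.map_injective (algebraMap ℚ ℂ).injective (h0.trans (Matrix.map_zero _ (map_zero _)).symm))

/-- `GL(ℝ) → GL(ℂ)` maps `-1` to `-1`. [folklore] -/
private theorem generalLinearGroup_map_ofRealHom_neg_one {ι : Type*} [Fintype ι] [DecidableEq ι] :
    Matrix.GeneralLinearGroup.map Complex.ofRealHom (-1 : GL ι ℝ) = -1 := by
  refine Units.ext ?_
  change ((-1 : GL ι ℝ) : Matrix ι ι ℝ).map Complex.ofRealHom = ((-1 : GL ι ℂ) : Matrix ι ι ℂ)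
  rw [Units.val_neg, Units.val_one, Units.val_neg, Units.val_one, Matrix.map_neg _ (map_neg Complex.ofRealHom),
    Matrix.map_one _ (map_zero _) (map_one _)]

/-- **`(1, −1) ∉ MT(X₁ × X₂)(ℝ)` when `Hom_ℚ(X₁, X₂) ≠ 0`** (real points). [cite: Moonen2004MT, §5 (5.6) Exercise, Hint (p. 12)]
[cite: Imai1976HodgeGroups, §3 Remarks (p. 370)] -/
theorem blockDiagGL_one_neg_one_not_mem_mumfordTateGroup_prod {B : Matrix ι₂ ι₁ ℚ} (hB : B ∈ homRat Φ₁ Φ₂)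
    (hB0 : B ≠ 0) : blockDiagGL ι₁ ι₂ ℝ (1, -1) ∉ mumfordTateGroup (prodPeriod Φ₁ Φ₂) := by
  rw [← map_ofRealHom_mem_mumfordTateGroupC_iff, map_blockDiagGL, map_one, generalLinearGroup_map_ofRealHom_neg_one]
  exact blockDiagGL_one_neg_one_not_mem_mumfordTateGroupC_prod Φ₁ Φ₂ hB hB0

/-- **`((1, −1), t) ∉ M̃T(X₁ × X₂)(ℝ)` for every `t`, when `Hom_ℚ(X₁, X₂) ≠ 0`** (its `GL(V₁ ⊕ V₂)`-component is not in
`MT(X₁ × X₂)`). [cite: Moonen2004MT, §4 Lemma 4.6 and §5 (5.6) Exercise, Hint] [cite: Imai1976HodgeGroups, §3 Remarks (p. 370)] -/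
theorem extGL_blockDiagGL_one_neg_one_not_mem_extMumfordTateGroup_prod {B : Matrix ι₂ ι₁ ℚ}
    (hB : B ∈ homRat Φ₁ Φ₂) (hB0 : B ≠ 0) (t : ℝˣ) :
    extGL (ι₁ ⊕ ι₂) ℝ (blockDiagGL ι₁ ι₂ ℝ (1, -1), t) ∉ extMumfordTateGroup (prodPeriod Φ₁ Φ₂) := fun h ↦
  blockDiagGL_one_neg_one_not_mem_mumfordTateGroup_prod Φ₁ Φ₂ hB hB0 (fst_mem_mumfordTateGroup_of_extGL_mem _ h)

/-- **… although `((1, −1), 1)` lies in the fibre product `M̃T(X₁)(ℝ) ×_{ℝ^×} M̃T(X₂)(ℝ)`**: `(1, 1) ∈ M̃T(X₁)` and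
`(−1, 1) = (h₂(e^{iπ}), 1) ∈ M̃T(X₂)` (the tree's `extGL_neg_one_one_mem_extMumfordTateGroup`).
[cite: Moonen1999MTNotes, (1.13), (1.14)] [cite: Lange2023AbelianVarietiesComplex, §7.1.1 Remark 7.1.2 (`h(-1) = -1_V`)] -/
theorem one_neg_one_one_mem_extFiberProd :
    (((1 : GL ι₁ ℝ), (-1 : GL ι₂ ℝ)), (1 : ℝˣ)) ∈ extFiberProd Φ₁ Φ₂ := by
  refine (mem_extFiberProd_iff Φ₁ Φ₂).2 ⟨?_, extGL_neg_one_one_mem_extMumfordTateGroup Φ₂⟩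
  change extGL ι₁ ℝ 1 ∈ extMumfordTateGroup Φ₁
  rw [map_one]
  exact (extMumfordTateGroup Φ₁).one_mem

/-- **STRICTNESS: `Hom_ℚ(X₁, X₂) ≠ 0 ⟹ M̃T(X₁ × X₂)(ℝ) ⊊ M̃T(X₁)(ℝ) ×_{ℝ^×} M̃T(X₂)(ℝ)`** — Moonen's (1.13)/(1.14)
inclusion for `M̃T` (the tree's `extMumfordTateGroup_prod_le`) is proper whenever there is a non-zero Hodge class in
`Hom(V₁, V₂)`, e.g. for isogenous tori (compare the tree's `hodgeGroup_prod_lt_of_homRat_ne_bot` for `Hg`, the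
same phenomenon by §1 when `X₁`, `X₂` are polarised). Witness: `((1, −1), 1)`. [cite: Moonen2004MT, §5 (5.6) Exercise, Hint (p. 12)]
[cite: Moonen1999MTNotes, (1.13) ("need not be an equality")] [cite: Imai1976HodgeGroups, §3 Remarks (p. 370)] -/
theorem extMumfordTateGroup_prod_lt_of_homRat_ne_bot (h : homRat Φ₁ Φ₂ ≠ ⊥) :
    extMumfordTateGroup (prodPeriod Φ₁ Φ₂) < (extFiberProd Φ₁ Φ₂).map (extProdGL ι₁ ι₂ ℝ) := by
  obtain ⟨B, hB, hB0⟩ := (Submodule.ne_bot_iff _).1 h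
  refine lt_of_le_of_ne (extMumfordTateGroup_prod_le Φ₁ Φ₂) fun he ↦ ?_
  have hmem : extProdGL ι₁ ι₂ ℝ (((1 : GL ι₁ ℝ), (-1 : GL ι₂ ℝ)), (1 : ℝˣ)) ∈
      (extFiberProd Φ₁ Φ₂).map (extProdGL ι₁ ι₂ ℝ) := ⟨_, one_neg_one_one_mem_extFiberProd Φ₁ Φ₂, rfl⟩
  rw [← he, extProdGL_apply] at hmem
  exact extGL_blockDiagGL_one_neg_one_not_mem_extMumfordTateGroup_prod Φ₁ Φ₂ hB hB0 1 hmem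

/-- **Isogenous tori: `M̃T(X₁ × X₂)(ℝ) ⊊ M̃T(X₁)(ℝ) ×_{ℝ^×} M̃T(X₂)(ℝ)`** (an isogeny is a non-zero Hodge class in
`Hom(V₁, V₂)`). [cite: Moonen2004MT, §5 (5.6) Exercise, Hint (p. 12)] [cite: Moonen1999MTNotes, (1.13)] -/
theorem IsIsogenous.extMumfordTateGroup_prod_lt [Nonempty ι₁] (h : IsIsogenous Φ₁ Φ₂) :
    extMumfordTateGroup (prodPeriod Φ₁ Φ₂) < (extFiberProd Φ₁ Φ₂).map (extProdGL ι₁ ι₂ ℝ) := by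
  obtain ⟨A, hA⟩ := h
  exact extMumfordTateGroup_prod_lt_of_homRat_ne_bot Φ₁ Φ₂ hA.homRat_ne_bot

/-- **`MT` level: `Hom_ℚ(X₁, X₂) ≠ 0 ⟹ MT(X₁ × X₂)(ℝ)` is NOT the fibre product of `MT(X₁)(ℝ)`, `MT(X₂)(ℝ)` over the
multipliers** — `(1, 1) ∈ M̃T(X₁)`, `(−1, 1) ∈ M̃T(X₂)` but `(1, −1) ∉ MT(X₁ × X₂)`. [cite: Moonen2004MT, §5 (5.6) Exercise, Hint (p. 12)]
[cite: Moonen1999MTNotes, (1.13) ("`MT(V)` is almost never equal to `MT(V₁) × MT(V₂)`")] -/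
theorem exists_not_mem_mumfordTateGroup_prod_of_homRat_ne_bot (h : homRat Φ₁ Φ₂ ≠ ⊥) :
    ∃ (A : GL ι₁ ℝ) (B : GL ι₂ ℝ) (t : ℝˣ), extGL ι₁ ℝ (A, t) ∈ extMumfordTateGroup Φ₁ ∧
      extGL ι₂ ℝ (B, t) ∈ extMumfordTateGroup Φ₂ ∧ blockDiagGL ι₁ ι₂ ℝ (A, B) ∉ mumfordTateGroup (prodPeriod Φ₁ Φ₂) := by
  obtain ⟨B, hB, hB0⟩ := (Submodule.ne_bot_iff _).1 h
  exact ⟨1, -1, 1, ((mem_extFiberProd_iff Φ₁ Φ₂).1 (one_neg_one_one_mem_extFiberProd Φ₁ Φ₂)).1,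
    extGL_neg_one_one_mem_extMumfordTateGroup Φ₂, blockDiagGL_one_neg_one_not_mem_mumfordTateGroup_prod Φ₁ Φ₂ hB hB0⟩

/-- **Isogenous tori: `M̃T(X₁ × X₂)(ℝ) ≅ M̃T(X₁)(ℝ)`** — `X₁ × X₂ ~ X₁ × X₁ = X₁²` (the tree's
`IsIsogenous.prod_powPeriod_two`), isogeny invariance of `M̃T` and `M̃T(X²)(ℝ) ≅ M̃T(X)(ℝ)` (the tree's functoriality
file: `IsIsogenous.nonempty_extMumfordTateGroup_mulEquiv`, `extMumfordTateGroupPowMulEquiv`); for isogenous elliptic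
curves this is Lombardo's case 6 "`𝔾_m · {(x, x) | x ∈ M}`" / Imai's "`{(x, λxλ⁻¹)}`" up to the centre: the second
factor contributes nothing new. [cite: Moonen1999MTNotes, (1.8), (1.13), (1.14)] [cite: Lombardo2019, §2.2, case 6 (arXiv:1610.09674 p. 4)]
[cite: Imai1976HodgeGroups, §3 Remarks (p. 370)] -/
theorem IsIsogenous.nonempty_extMumfordTateGroup_prod_mulEquiv (h : IsIsogenous Φ₁ Φ₂) :
    Nonempty (extMumfordTateGroup (prodPeriod Φ₁ Φ₂) ≃* extMumfordTateGroup Φ₁) := by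
  obtain ⟨e⟩ := (IsIsogenous.prod_powPeriod_two (IsIsogenous.refl Φ₁)
    (IsIsogenous.symm _ _ h)).nonempty_extMumfordTateGroup_mulEquiv
  exact ⟨e.trans (extMumfordTateGroupPowMulEquiv 2 Φ₁ two_pos).symm⟩

end Strict

/-! ## §3 Moonen 2004, Exercise (5.6): `MT` and `M̃T` of a product of two elliptic curves -/

section EllipticCurves

variable {τ₁ τ₂ : ℂ} (hτ₁ : τ₁.im ≠ 0) (hτ₂ : τ₂.im ≠ 0)

/-- **`M̃T(E_τ)(ℝ) = {(A, det A) : A ∈ MT(E_τ)(ℝ)}` for EVERY elliptic curve** (with or without complex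
multiplication): `(A, t) ∈ M̃T(E_τ)(ℝ) ⟺ A ∈ MT(E_τ)(ℝ) ∧ det A = t` — Moonen's `M̃T ⥲ MT` for the polarised weight-one
Hodge structure `H₁(E_τ)` with `ν = det` (`GSp₂ = GL₂`); with `MT(E_τ)(ℝ) = GL₂(ℝ)` resp. `= {h(z)} = (K ⊗ ℝ)^×` this is
the tree's `extGL_mem_extMumfordTateGroup_ellipticPeriod_iff_of_eq_bot` / `_of_ne_bot`.
[cite: Moonen2004MT, §4 (4.8) and §5 (5.2)] [cite: CarlsonMullerStachPeters2017, §15.2 Examples 15.2.4 (ii)] -/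
theorem extGL_mem_extMumfordTateGroup_ellipticPeriod_iff {τ : ℂ} (hτ : τ.im ≠ 0) {A : GL (Fin 2) ℝ} {t : ℝˣ} :
    extGL (Fin 2) ℝ (A, t) ∈ extMumfordTateGroup (ellipticPeriod hτ) ↔
      A ∈ mumfordTateGroup (ellipticPeriod hτ) ∧ (A : Matrix (Fin 2) (Fin 2) ℝ).det = t := by
  rw [extGL_mem_extMumfordTateGroup_iff (ellipticForm_I_smul hτ) ⟨_, map_ratCast_stdGram_eq_latticeGram_elliptic hτ⟩
    (latticeGram_elliptic_ne_zero hτ), latticeGram_elliptic, transpose_mul_stdGram_mul_eq_det_smul]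
  refine and_congr_right fun _ ↦ ⟨fun h ↦ ?_, fun h ↦ by rw [h]⟩
  have h01 := congrFun (congrFun h 0) 1
  simpa using h01

include hτ₁ hτ₂ in
/-- **`det A = det B` on `MT(E_τ₁ × E_τ₂)(ℝ)` for ANY two elliptic curves** (isogenous or not): the common multiplier of
`(A 0; 0 B)` on the product polarisation is `det A = det B` (sharpening the tree's `(det A)² = (det B)²` of
`det_pow_eq_of_blockDiagGL_mem_mumfordTateGroup_prod`). [cite: Moonen2004MT, §4 Lemma 4.6, (4.7) and §5 (5.6) Exercise]
[cite: Gordon1997, Lemma 2.7] -/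
theorem det_eq_det_of_blockDiagGL_mem_mumfordTateGroup_prod_ellipticPeriod {A B : GL (Fin 2) ℝ}
    (h : blockDiagGL (Fin 2) (Fin 2) ℝ (A, B) ∈ mumfordTateGroup (prodPeriod (ellipticPeriod hτ₁) (ellipticPeriod hτ₂))) :
    (A : Matrix (Fin 2) (Fin 2) ℝ).det = (B : Matrix (Fin 2) (Fin 2) ℝ).det := by
  obtain ⟨ν, hA, hB⟩ := exists_common_multiplier_of_blockDiagGL_mem_mumfordTateGroup_prod (ellipticForm_I_smul hτ₁)
    ⟨_, map_ratCast_stdGram_eq_latticeGram_elliptic hτ₁⟩ (ellipticForm_I_smul hτ₂)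
    ⟨_, map_ratCast_stdGram_eq_latticeGram_elliptic hτ₂⟩ h
  rw [latticeGram_elliptic, transpose_mul_stdGram_mul_eq_det_smul] at hA hB
  have hA01 := congrFun (congrFun hA 0) 1
  have hB01 := congrFun (congrFun hB 0) 1
  simp only [Matrix.smul_apply, Matrix.of_apply, Matrix.cons_val', Matrix.cons_val_one, Matrix.cons_val_fin_one,
    Matrix.cons_val_zero, smul_eq_mul, mul_one] at hA01 hB01
  rw [hA01, hB01]

/-- **Scaling into the Hodge group**: for any elliptic curve `E_τ` and `A ∈ MT(E_τ)(ℝ)` with `det A = r²`, `r > 0`,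
`A = r · a` with `a ∈ Hg(E_τ)(ℝ)` (`Hg = SL₂` without CM; with CM `A = h(z)`, `|z| = r`, `a = h(z/|z|) ∈ h(U¹) = Hg`).
[cite: CarlsonMullerStachPeters2017, §15.2 Examples 15.2.4 (ii)] [cite: Moonen1999MTNotes, (1.11)] -/
theorem exists_mem_hodgeGroup_coe_eq_smul_of_mem_mumfordTateGroup_ellipticPeriod {τ : ℂ} (hτ : τ.im ≠ 0)
    {A : GL (Fin 2) ℝ} (hA : A ∈ mumfordTateGroup (ellipticPeriod hτ)) {r : ℝ} (hr : 0 < r)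
    (hdet : (A : Matrix (Fin 2) (Fin 2) ℝ).det = r ^ 2) :
    ∃ a ∈ hodgeGroup (ellipticPeriod hτ), (A : Matrix (Fin 2) (Fin 2) ℝ) = r • (a : Matrix (Fin 2) (Fin 2) ℝ) := by
  by_cases hE : ellipticEnd hτ = ⊥
  · refine ⟨⟨r⁻¹ • (A : Matrix (Fin 2) (Fin 2) ℝ), ?_⟩, ?_, ?_⟩
    · rw [Matrix.det_smul, hdet, Fintype.card_fin, inv_pow, inv_mul_cancel₀ (pow_ne_zero 2 hr.ne')]
    · rw [hodgeGroup_ellipticPeriod_eq_top_of_eq_bot hτ hE]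
      exact Subgroup.mem_top _
    · change (A : Matrix (Fin 2) (Fin 2) ℝ) = r • (r⁻¹ • (A : Matrix (Fin 2) (Fin 2) ℝ))
      rw [smul_smul, mul_inv_cancel₀ hr.ne', one_smul]
  · obtain ⟨z, hz, hAz⟩ := (mem_mumfordTateGroup_ellipticPeriod_iff_of_ne_bot hτ hE).1 hA
    have hnorm : ‖z‖ = r := by
      have h2 : ‖z‖ ^ 2 = r ^ 2 := by
        rw [← hdet, hAz, det_hodgeS, Fintype.card_fin]
      exact (sq_eq_sq₀ (norm_nonneg z) hr.le).1 h2
    refine ⟨hodgeCircleSL (ellipticPeriod hτ) (Complex.arg z), hodgeCircleSL_mem_hodgeGroup _ _, ?_⟩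
    rw [hAz, hodgeS_eq_norm_smul_hodgeCircle, hnorm, coe_hodgeCircleSL]

/-- With complex multiplication `det A > 0` on `MT(E_τ)(ℝ) = {h(z)}` (`det h(z) = |z|²`).
[cite: CarlsonMullerStachPeters2017, §15.2 Examples 15.2.4 (ii)] -/
theorem det_pos_of_mem_mumfordTateGroup_ellipticPeriod_of_ne_bot {τ : ℂ} (hτ : τ.im ≠ 0) (hE : ellipticEnd hτ ≠ ⊥)
    {A : GL (Fin 2) ℝ} (hA : A ∈ mumfordTateGroup (ellipticPeriod hτ)) : 0 < (A : Matrix (Fin 2) (Fin 2) ℝ).det := by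
  obtain ⟨z, hz, hAz⟩ := (mem_mumfordTateGroup_ellipticPeriod_iff_of_ne_bot hτ hE).1 hA
  rw [hAz, det_hodgeS, Fintype.card_fin]
  exact pow_pos (norm_pos_iff.2 hz) 2

include hτ₁ hτ₂ in
/-- **Moonen 2004, Exercise (5.6), non-isogenous curves — the hard inclusion: for `E_τ₁ ≁ E_τ₂` (any combination of
CM / non-CM), `A ∈ MT(E_τ₁)(ℝ)`, `B ∈ MT(E_τ₂)(ℝ)` and `det A = det B` imply `(A 0; 0 B) ∈ MT(E_τ₁ × E_τ₂)(ℝ)`.**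
Without CM on both sides: `Hg(E_τ₁ × E_τ₂)(ℂ) = SL₂(ℂ) × SL₂(ℂ)` (Imai / the tree's
`hodgeGroupC_prod_ellipticPeriod_eq_of_eq_bot_of_eq_bot`) and §1; with a CM factor `det A = det B = r² > 0` and
`(A, B) = r · (a, b)` with `(a, b) ∈ Hg(E_τ₁)(ℝ) × Hg(E_τ₂)(ℝ) = Hg(E_τ₁ × E_τ₂)(ℝ)` (Imai's Proposition, the tree's
`hodgeGroup_prod_ellipticPeriod_eq_of_not_isIsogenous'`), `r · 1 ∈ MT`. [cite: Moonen2004MT, §5 (5.6) Exercise (p. 12)]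
[cite: Imai1976HodgeGroups, §2 Proposition (p. 368)] [cite: MoonenZarhin1999LowDim, §3 Corollary] -/
theorem blockDiagGL_mem_mumfordTateGroup_prod_ellipticPeriod_of_not_isIsogenous
    (hiso : ¬ IsIsogenous (ellipticPeriod hτ₁) (ellipticPeriod hτ₂)) {A B : GL (Fin 2) ℝ}
    (hA : A ∈ mumfordTateGroup (ellipticPeriod hτ₁)) (hB : B ∈ mumfordTateGroup (ellipticPeriod hτ₂))
    (hdet : (A : Matrix (Fin 2) (Fin 2) ℝ).det = (B : Matrix (Fin 2) (Fin 2) ℝ).det) :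
    blockDiagGL (Fin 2) (Fin 2) ℝ (A, B) ∈ mumfordTateGroup (prodPeriod (ellipticPeriod hτ₁) (ellipticPeriod hτ₂)) := by
  by_cases hCM : ellipticEnd hτ₁ = ⊥ ∧ ellipticEnd hτ₂ = ⊥
  · -- no complex multiplication: complex points and §1
    have hHg : ∀ N₁ ∈ hodgeGroupC (ellipticPeriod hτ₁), ∀ N₂ ∈ hodgeGroupC (ellipticPeriod hτ₂),
        blockDiagC (Fin 2) (Fin 2) (N₁, N₂) ∈ hodgeGroupC (prodPeriod (ellipticPeriod hτ₁) (ellipticPeriod hτ₂)) := by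
      intro N₁ _ N₂ _
      rw [hodgeGroupC_prod_ellipticPeriod_eq_of_eq_bot_of_eq_bot hτ₁ hτ₂ hCM.1 hCM.2 hiso]
      exact ⟨(N₁, N₂), Subgroup.mem_prod.2 ⟨Subgroup.mem_top _, Subgroup.mem_top _⟩, rfl⟩
    refine (blockDiagGL_mem_mumfordTateGroup_prod_iff_of_forall_blockDiagC_mem _ _ (ellipticForm_I_smul hτ₁)
      ⟨_, map_ratCast_stdGram_eq_latticeGram_elliptic hτ₁⟩ (latticeGram_elliptic_ne_zero hτ₁) (ellipticForm_I_smul hτ₂)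
      ⟨_, map_ratCast_stdGram_eq_latticeGram_elliptic hτ₂⟩ (latticeGram_elliptic_ne_zero hτ₂) hHg).2
      ⟨Matrix.GeneralLinearGroup.det A, ?_, ?_⟩
    · exact (extGL_mem_extMumfordTateGroup_ellipticPeriod_iff hτ₁).2 ⟨hA, rfl⟩
    · exact (extGL_mem_extMumfordTateGroup_ellipticPeriod_iff hτ₂).2 ⟨hB, by rw [← hdet]; rfl⟩
  · -- a CM factor: the common determinant is positive; scale into the Hodge groups
    have hpos : 0 < (A : Matrix (Fin 2) (Fin 2) ℝ).det := by
      by_cases h₁ : ellipticEnd hτ₁ = ⊥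
      · rw [hdet]
        exact det_pos_of_mem_mumfordTateGroup_ellipticPeriod_of_ne_bot hτ₂ (fun h₂ ↦ hCM ⟨h₁, h₂⟩) hB
      · exact det_pos_of_mem_mumfordTateGroup_ellipticPeriod_of_ne_bot hτ₁ h₁ hA
    set r : ℝ := Real.sqrt (A : Matrix (Fin 2) (Fin 2) ℝ).det with hr
    have hr0 : 0 < r := Real.sqrt_pos.2 hpos
    have hr2 : (A : Matrix (Fin 2) (Fin 2) ℝ).det = r ^ 2 := (Real.sq_sqrt hpos.le).symm
    obtain ⟨a, ha, hAa⟩ := exists_mem_hodgeGroup_coe_eq_smul_of_mem_mumfordTateGroup_ellipticPeriod hτ₁ hA hr0 hr2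
    obtain ⟨b, hb, hBb⟩ := exists_mem_hodgeGroup_coe_eq_smul_of_mem_mumfordTateGroup_ellipticPeriod hτ₂ hB hr0
      (by rw [← hdet, hr2])
    have hab : blockDiag (Fin 2) (Fin 2) (a, b) ∈ hodgeGroup (prodPeriod (ellipticPeriod hτ₁) (ellipticPeriod hτ₂)) := by
      rw [hodgeGroup_prod_ellipticPeriod_eq_of_not_isIsogenous' hτ₁ hτ₂ hiso]
      exact ⟨(a, b), Subgroup.mem_prod.2 ⟨ha, hb⟩, rfl⟩
    have hmem := scalar_mul_toGL_mem_mumfordTateGroup (prodPeriod (ellipticPeriod hτ₁) (ellipticPeriod hτ₂))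
      (Units.mk0 r hr0.ne') hab
    have he : blockDiagGL (Fin 2) (Fin 2) ℝ (A, B) = Matrix.GeneralLinearGroup.scalar (Fin 2 ⊕ Fin 2) (Units.mk0 r hr0.ne') *
        Matrix.SpecialLinearGroup.toGL (blockDiag (Fin 2) (Fin 2) (a, b)) := by
      rw [toGL_blockDiag, scalar_mul_blockDiagGL]
      congr 1
      refine Prod.ext (Units.ext ?_) (Units.ext ?_)
      · rw [coe_scalar_mul', Matrix.SpecialLinearGroup.coe_GL_coe_matrix, hAa]; rfl
      · rw [coe_scalar_mul', Matrix.SpecialLinearGroup.coe_GL_coe_matrix, hBb]; rfl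
    rw [he]
    exact hmem

include hτ₁ hτ₂ in
/-- **Moonen 2004, Exercise (5.6) for NON-ISOGENOUS curves, on blocks: `(A 0; 0 B) ∈ MT(E_τ₁ × E_τ₂)(ℝ) ⟺
A ∈ MT(E_τ₁)(ℝ), B ∈ MT(E_τ₂)(ℝ), det A = det B`** — in Moonen's list: `End⁰ = ℚ, ℚ`: `MT = GL₂ ×_{det} GL₂`
(`{(A, B) : det A = det B}`); `End⁰ = ℚ, K`: `GL₂ ×_{det, Nm} T_K`; `End⁰ = K₁, K₂` (`E_τ₁ ≁ E_τ₂`):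
`T_{K₁} ×_{Nm} T_{K₂}`, read on real points with `MT(E_τ)(ℝ) = GL₂(ℝ)` (no CM, the tree's
`mumfordTateGroup_ellipticPeriod_eq_top_of_eq_bot`) resp. `= {h(z) : z ∈ ℂ^×} = (K ⊗ ℝ)^×` (CM,
`mem_mumfordTateGroup_ellipticPeriod_iff_of_ne_bot`); Lombardo: "`MT ≅ 𝔾_m · (M₁ × M₂)`", `Mᵢ = SL₂` resp. the
norm-one torus of `Fᵢ`. [cite: Moonen2004MT, §5 (5.6) Exercise (p. 12)] [cite: Lombardo2019, §2.2, case 5 (arXiv:1610.09674 p. 4)]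
[cite: Imai1976HodgeGroups, §2 Proposition (p. 368)] [cite: CarlsonMullerStachPeters2017, §15.2 Examples 15.2.4 (ii)] -/
theorem blockDiagGL_mem_mumfordTateGroup_prod_ellipticPeriod_iff_of_not_isIsogenous
    (hiso : ¬ IsIsogenous (ellipticPeriod hτ₁) (ellipticPeriod hτ₂)) {A B : GL (Fin 2) ℝ} :
    blockDiagGL (Fin 2) (Fin 2) ℝ (A, B) ∈ mumfordTateGroup (prodPeriod (ellipticPeriod hτ₁) (ellipticPeriod hτ₂)) ↔
      A ∈ mumfordTateGroup (ellipticPeriod hτ₁) ∧ B ∈ mumfordTateGroup (ellipticPeriod hτ₂) ∧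
        (A : Matrix (Fin 2) (Fin 2) ℝ).det = (B : Matrix (Fin 2) (Fin 2) ℝ).det :=
  ⟨fun h ↦ ⟨fst_mem_mumfordTateGroup_of_blockDiagGL_mem _ _ h, snd_mem_mumfordTateGroup_of_blockDiagGL_mem _ _ h,
    det_eq_det_of_blockDiagGL_mem_mumfordTateGroup_prod_ellipticPeriod hτ₁ hτ₂ h⟩,
    fun ⟨hA, hB, hdet⟩ ↦ blockDiagGL_mem_mumfordTateGroup_prod_ellipticPeriod_of_not_isIsogenous hτ₁ hτ₂ hiso hA hB hdet⟩

include hτ₁ hτ₂ in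
/-- **Moonen 2004, Exercise (5.6) for non-isogenous curves, on elements:
`MT(E_τ₁ × E_τ₂)(ℝ) = {(A 0; 0 B) : A ∈ MT(E_τ₁)(ℝ), B ∈ MT(E_τ₂)(ℝ), det A = det B}`** ("`MT ≅ 𝔾_m · (M₁ × M₂)`").
[cite: Moonen2004MT, §5 (5.6) Exercise (p. 12)] [cite: Lombardo2019, §2.2, case 5 (arXiv:1610.09674 p. 4)]
[cite: Imai1976HodgeGroups, §2 Proposition (p. 368)] [cite: MoonenZarhin1999LowDim, §3 Corollary] -/
theorem mem_mumfordTateGroup_prod_ellipticPeriod_iff_of_not_isIsogenous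
    (hiso : ¬ IsIsogenous (ellipticPeriod hτ₁) (ellipticPeriod hτ₂)) {M : GL (Fin 2 ⊕ Fin 2) ℝ} :
    M ∈ mumfordTateGroup (prodPeriod (ellipticPeriod hτ₁) (ellipticPeriod hτ₂)) ↔
      ∃ A ∈ mumfordTateGroup (ellipticPeriod hτ₁), ∃ B ∈ mumfordTateGroup (ellipticPeriod hτ₂),
        (A : Matrix (Fin 2) (Fin 2) ℝ).det = (B : Matrix (Fin 2) (Fin 2) ℝ).det ∧ M = blockDiagGL (Fin 2) (Fin 2) ℝ (A, B) := by
  constructor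
  · intro h
    obtain ⟨A, -, B, -, rfl⟩ := exists_eq_blockDiagGL_of_mem_mumfordTateGroup_prod _ _ h
    obtain ⟨hA, hB, hdet⟩ := (blockDiagGL_mem_mumfordTateGroup_prod_ellipticPeriod_iff_of_not_isIsogenous hτ₁ hτ₂ hiso).1 h
    exact ⟨A, hA, B, hB, hdet, rfl⟩
  · rintro ⟨A, hA, B, hB, hdet, rfl⟩
    exact blockDiagGL_mem_mumfordTateGroup_prod_ellipticPeriod_of_not_isIsogenous hτ₁ hτ₂ hiso hA hB hdet

include hτ₁ hτ₂ in
/-- **`M̃T` of a product of elliptic curves on blocks: `((A 0; 0 B), t) ∈ M̃T(E_τ₁ × E_τ₂)(ℝ) ⟺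
(A 0; 0 B) ∈ MT(E_τ₁ × E_τ₂)(ℝ) ∧ det A = t ∧ det B = t`** (any two curves; product polarisation, `ν = det` on each
block). [cite: Moonen2004MT, §4 Lemma 4.6, (4.7) and §5 (5.2)] [cite: Moonen1999MTNotes, (1.14)] -/
theorem extGL_blockDiagGL_mem_extMumfordTateGroup_prod_ellipticPeriod_iff {A B : GL (Fin 2) ℝ} {t : ℝˣ} :
    extGL (Fin 2 ⊕ Fin 2) ℝ (blockDiagGL (Fin 2) (Fin 2) ℝ (A, B), t) ∈
        extMumfordTateGroup (prodPeriod (ellipticPeriod hτ₁) (ellipticPeriod hτ₂)) ↔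
      blockDiagGL (Fin 2) (Fin 2) ℝ (A, B) ∈ mumfordTateGroup (prodPeriod (ellipticPeriod hτ₁) (ellipticPeriod hτ₂)) ∧
        (A : Matrix (Fin 2) (Fin 2) ℝ).det = t ∧ (B : Matrix (Fin 2) (Fin 2) ℝ).det = t := by
  refine ⟨fun h ↦ ⟨fst_mem_mumfordTateGroup_of_extGL_mem _ h,
    ((extGL_mem_extMumfordTateGroup_ellipticPeriod_iff hτ₁).1 (extGL_fst_mem_extMumfordTateGroup_of_mem_prod _ _ h)).2,
    ((extGL_mem_extMumfordTateGroup_ellipticPeriod_iff hτ₂).1 (extGL_snd_mem_extMumfordTateGroup_of_mem_prod _ _ h)).2⟩,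
    fun ⟨h, hA, hB⟩ ↦ ?_⟩
  refine extGL_mem_extMumfordTateGroup_of_mem_mumfordTateGroup (prodForm_I_smul (ellipticForm_I_smul hτ₁)
    (ellipticForm_I_smul hτ₂)) (exists_ratMatrix_latticeGram_prodForm ⟨_, map_ratCast_stdGram_eq_latticeGram_elliptic hτ₁⟩
    ⟨_, map_ratCast_stdGram_eq_latticeGram_elliptic hτ₂⟩)
    (latticeGram_prodForm_ne_zero_of_left _ _ (latticeGram_elliptic_ne_zero hτ₁)) h ?_
  change (Matrix.fromBlocks (A : Matrix (Fin 2) (Fin 2) ℝ) 0 0 (B : Matrix (Fin 2) (Fin 2) ℝ))ᵀ * _ *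
      Matrix.fromBlocks (A : Matrix (Fin 2) (Fin 2) ℝ) 0 0 (B : Matrix (Fin 2) (Fin 2) ℝ) = _
  rw [latticeGram_prod, Matrix.fromBlocks_transpose, Matrix.fromBlocks_multiply, Matrix.fromBlocks_multiply,
    Matrix.fromBlocks_smul]
  simp only [Matrix.transpose_zero, Matrix.zero_mul, Matrix.mul_zero, add_zero, zero_add, smul_zero]
  rw [latticeGram_elliptic, latticeGram_elliptic, transpose_mul_stdGram_mul_eq_det_smul,
    transpose_mul_stdGram_mul_eq_det_smul, hA, hB]

include hτ₁ hτ₂ in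
/-- **Moonen 2004, Exercise (5.6) for `M̃T`, NON-ISOGENOUS curves, on blocks: `((A 0; 0 B), t) ∈ M̃T(E_τ₁ × E_τ₂)(ℝ)
⟺ (A, t) ∈ M̃T(E_τ₁)(ℝ) ∧ (B, t) ∈ M̃T(E_τ₂)(ℝ)` ⟺ `A ∈ MT(E_τ₁)(ℝ), B ∈ MT(E_τ₂)(ℝ), det A = det B = t`.**
[cite: Moonen2004MT, §5 (5.6) Exercise (p. 12)] [cite: Moonen1999MTNotes, (1.13), (1.14)] -/
theorem extGL_blockDiagGL_mem_extMumfordTateGroup_prod_ellipticPeriod_iff_of_not_isIsogenous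
    (hiso : ¬ IsIsogenous (ellipticPeriod hτ₁) (ellipticPeriod hτ₂)) {A B : GL (Fin 2) ℝ} {t : ℝˣ} :
    extGL (Fin 2 ⊕ Fin 2) ℝ (blockDiagGL (Fin 2) (Fin 2) ℝ (A, B), t) ∈
        extMumfordTateGroup (prodPeriod (ellipticPeriod hτ₁) (ellipticPeriod hτ₂)) ↔
      extGL (Fin 2) ℝ (A, t) ∈ extMumfordTateGroup (ellipticPeriod hτ₁) ∧
        extGL (Fin 2) ℝ (B, t) ∈ extMumfordTateGroup (ellipticPeriod hτ₂) := by
  rw [extGL_blockDiagGL_mem_extMumfordTateGroup_prod_ellipticPeriod_iff hτ₁ hτ₂,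
    extGL_mem_extMumfordTateGroup_ellipticPeriod_iff hτ₁, extGL_mem_extMumfordTateGroup_ellipticPeriod_iff hτ₂,
    blockDiagGL_mem_mumfordTateGroup_prod_ellipticPeriod_iff_of_not_isIsogenous hτ₁ hτ₂ hiso]
  constructor
  · rintro ⟨⟨hA, hB, -⟩, hdA, hdB⟩
    exact ⟨⟨hA, hdA⟩, hB, hdB⟩
  · rintro ⟨⟨hA, hdA⟩, hB, hdB⟩
    exact ⟨⟨hA, hB, by rw [hdA, hdB]⟩, hdA, hdB⟩

include hτ₁ hτ₂ in
/-- **EQUALITY IN (1.13) FOR NON-ISOGENOUS ELLIPTIC CURVES: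
`M̃T(E_τ₁ × E_τ₂)(ℝ) = M̃T(E_τ₁)(ℝ) ×_{ℝ^×} M̃T(E_τ₂)(ℝ) = {((A 0; 0 B), t) : A ∈ MT(E_τ₁)(ℝ), B ∈ MT(E_τ₂)(ℝ), det A = det B = t}`**
(all four CM / non-CM combinations). [cite: Moonen2004MT, §5 (5.6) Exercise (p. 12)] [cite: Moonen1999MTNotes, (1.13), (1.14)]
[cite: Imai1976HodgeGroups, §2 Proposition (p. 368)] -/
theorem extMumfordTateGroup_prod_ellipticPeriod_eq_of_not_isIsogenous
    (hiso : ¬ IsIsogenous (ellipticPeriod hτ₁) (ellipticPeriod hτ₂)) :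
    extMumfordTateGroup (prodPeriod (ellipticPeriod hτ₁) (ellipticPeriod hτ₂)) =
      (extFiberProd (ellipticPeriod hτ₁) (ellipticPeriod hτ₂)).map (extProdGL (Fin 2) (Fin 2) ℝ) := by
  refine le_antisymm (extMumfordTateGroup_prod_le _ _) ?_
  rintro _ ⟨x, hx, rfl⟩
  obtain ⟨⟨A, B⟩, t⟩ := x
  have hA : extGL (Fin 2) ℝ (A, t) ∈ extMumfordTateGroup (ellipticPeriod hτ₁) :=
    ((mem_extFiberProd_iff (ellipticPeriod hτ₁) (ellipticPeriod hτ₂)).1 hx).1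
  have hB : extGL (Fin 2) ℝ (B, t) ∈ extMumfordTateGroup (ellipticPeriod hτ₂) :=
    ((mem_extFiberProd_iff (ellipticPeriod hτ₁) (ellipticPeriod hτ₂)).1 hx).2
  rw [extProdGL_apply]
  exact (extGL_blockDiagGL_mem_extMumfordTateGroup_prod_ellipticPeriod_iff_of_not_isIsogenous hτ₁ hτ₂ hiso).2 ⟨hA, hB⟩

include hτ₁ hτ₂ in
/-- **Moonen 2004, Exercise (5.6), the dichotomy for `M̃T`: `M̃T(E_τ₁ × E_τ₂) = M̃T(E_τ₁) ×_{𝔾_m} M̃T(E_τ₂) ⟺ E_τ₁ ≁ E_τ₂`**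
(real points; for isogenous curves the inclusion is proper, §2 — "`E₁` and `E₂` are isogenous if and only if there is
… a non-zero Hodge class in `Hom(V₁, V₂)`"). [cite: Moonen2004MT, §5 (5.6) Exercise with Hint (p. 12)]
[cite: Imai1976HodgeGroups, §2 Proposition and §3 Remarks] [cite: Moonen1999MTNotes, (1.13)] -/
theorem extMumfordTateGroup_prod_ellipticPeriod_eq_iff_not_isIsogenous :
    extMumfordTateGroup (prodPeriod (ellipticPeriod hτ₁) (ellipticPeriod hτ₂)) =
        (extFiberProd (ellipticPeriod hτ₁) (ellipticPeriod hτ₂)).map (extProdGL (Fin 2) (Fin 2) ℝ) ↔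
      ¬ IsIsogenous (ellipticPeriod hτ₁) (ellipticPeriod hτ₂) :=
  ⟨fun h hi ↦ (hi.extMumfordTateGroup_prod_lt _ _).ne h,
    extMumfordTateGroup_prod_ellipticPeriod_eq_of_not_isIsogenous hτ₁ hτ₂⟩

include hτ₁ hτ₂ in
/-- **Moonen 2004, Exercise (5.6), ISOGENOUS curves: `(1, −1) ∉ MT(E_τ₁ × E_τ₂)(ℝ)`** although `1 ∈ MT(E_τ₁)`,
`−1 ∈ MT(E_τ₂)` and `det 1 = det(−1)`: the description of the non-isogenous case fails, `MT(E_τ₁ × E_τ₂)` being the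
graph `{(x, λxλ⁻¹)}` up to the centre (Imai; Lombardo's case 6: "`𝔾_m · {(x, x) | x ∈ M}`" for `E × E`).
[cite: Moonen2004MT, §5 (5.6) Exercise, Hint (p. 12)] [cite: Imai1976HodgeGroups, §3 Remarks (p. 370)]
[cite: Lombardo2019, §2.2, case 6 (arXiv:1610.09674 p. 4)] -/
theorem blockDiagGL_one_neg_one_not_mem_mumfordTateGroup_prod_ellipticPeriod_of_isIsogenous
    (hi : IsIsogenous (ellipticPeriod hτ₁) (ellipticPeriod hτ₂)) :
    blockDiagGL (Fin 2) (Fin 2) ℝ (1, -1) ∉ mumfordTateGroup (prodPeriod (ellipticPeriod hτ₁) (ellipticPeriod hτ₂)) := by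
  obtain ⟨M, hM⟩ := hi
  obtain ⟨B, hB, hB0⟩ := (Submodule.ne_bot_iff _).1 hM.homRat_ne_bot
  exact blockDiagGL_one_neg_one_not_mem_mumfordTateGroup_prod _ _ hB hB0

include hτ₁ hτ₂ in
/-- **Moonen's first case on complex points — `End⁰(E₁) = End⁰(E₂) = ℚ`, `E₁ ≁ E₂`:
`M̃T(E_τ₁ × E_τ₂)(ℂ) = GL₂(ℂ) ×_{det} GL₂(ℂ)`**, i.e. `((A 0; 0 B), c) ∈ M̃T(E_τ₁ × E_τ₂)(ℂ) ⟺ det A = c = det B`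
(§1 with `Hg(E_τ₁ × E_τ₂)(ℂ) = SL₂(ℂ) × SL₂(ℂ)`, the tree's `hodgeGroupC_prod_ellipticPeriod_eq_of_eq_bot_of_eq_bot`, and
`M̃T(E_τ)(ℂ) = {(g, det g)}`, the tree's `extGL_mem_extMumfordTateGroupC_ellipticPeriod_iff_of_eq_bot`).
[cite: Moonen2004MT, §5 (5.6) Exercise (p. 12)] [cite: CarlsonMullerStachPeters2017, §15.2 Examples 15.2.4 (ii) ("`MT(H¹(C)) = GL(2)`")]
[cite: Imai1976HodgeGroups, §2 Proposition (p. 368)] -/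
theorem extGL_blockDiagGL_mem_extMumfordTateGroupC_prod_ellipticPeriod_iff_of_eq_bot_of_eq_bot
    (h₁ : ellipticEnd hτ₁ = ⊥) (h₂ : ellipticEnd hτ₂ = ⊥) (hiso : ¬ IsIsogenous (ellipticPeriod hτ₁) (ellipticPeriod hτ₂))
    {A B : GL (Fin 2) ℂ} {c : ℂˣ} :
    extGL (Fin 2 ⊕ Fin 2) ℂ (blockDiagGL (Fin 2) (Fin 2) ℂ (A, B), c) ∈
        extMumfordTateGroupC (prodPeriod (ellipticPeriod hτ₁) (ellipticPeriod hτ₂)) ↔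
      (A : Matrix (Fin 2) (Fin 2) ℂ).det = c ∧ (B : Matrix (Fin 2) (Fin 2) ℂ).det = c := by
  have hHg : ∀ N₁ ∈ hodgeGroupC (ellipticPeriod hτ₁), ∀ N₂ ∈ hodgeGroupC (ellipticPeriod hτ₂),
      blockDiagC (Fin 2) (Fin 2) (N₁, N₂) ∈ hodgeGroupC (prodPeriod (ellipticPeriod hτ₁) (ellipticPeriod hτ₂)) := by
    intro N₁ _ N₂ _
    rw [hodgeGroupC_prod_ellipticPeriod_eq_of_eq_bot_of_eq_bot hτ₁ hτ₂ h₁ h₂ hiso]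
    exact ⟨(N₁, N₂), Subgroup.mem_prod.2 ⟨Subgroup.mem_top _, Subgroup.mem_top _⟩, rfl⟩
  rw [← extGL_mem_extMumfordTateGroupC_ellipticPeriod_iff_of_eq_bot hτ₁ h₁,
    ← extGL_mem_extMumfordTateGroupC_ellipticPeriod_iff_of_eq_bot hτ₂ h₂]
  refine ⟨fun h ↦ ⟨extGL_fst_mem_extMumfordTateGroupC_of_mem_prod _ _ h,
    extGL_snd_mem_extMumfordTateGroupC_of_mem_prod _ _ h⟩, fun ⟨hA, hB⟩ ↦ ?_⟩
  exact extProdGL_mem_extMumfordTateGroupC_prod_of_forall_blockDiagC_mem _ _ (ellipticForm_I_smul hτ₁)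
    ⟨_, map_ratCast_stdGram_eq_latticeGram_elliptic hτ₁⟩ (latticeGram_elliptic_ne_zero hτ₁) (ellipticForm_I_smul hτ₂)
    ⟨_, map_ratCast_stdGram_eq_latticeGram_elliptic hτ₂⟩ (latticeGram_elliptic_ne_zero hτ₂) hHg (x := ((A, B), c))
    ((mem_extFiberProdC_iff _ _).2 ⟨hA, hB⟩)

include hτ₁ hτ₂ in
/-- **`End⁰(E₁) = End⁰(E₂) = ℚ`, `E₁ ≁ E₂`, complex points: `MT(E_τ₁ × E_τ₂)(ℂ) = {(A 0; 0 B) ∈ GL₂(ℂ) × GL₂(ℂ) :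
det A = det B}`** (`= 𝔾_m · (SL₂ × SL₂)`, of dimension `7`; CMSP: "`MT(H¹(C)) = GL(2)`" for each factor).
[cite: Moonen2004MT, §5 (5.6) Exercise (p. 12)] [cite: CarlsonMullerStachPeters2017, §15.2 Examples 15.2.4 (ii)]
[cite: Imai1976HodgeGroups, §2 Proposition (p. 368)] -/
theorem blockDiagGL_mem_mumfordTateGroupC_prod_ellipticPeriod_iff_of_eq_bot_of_eq_bot
    (h₁ : ellipticEnd hτ₁ = ⊥) (h₂ : ellipticEnd hτ₂ = ⊥) (hiso : ¬ IsIsogenous (ellipticPeriod hτ₁) (ellipticPeriod hτ₂))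
    {A B : GL (Fin 2) ℂ} :
    blockDiagGL (Fin 2) (Fin 2) ℂ (A, B) ∈ mumfordTateGroupC (prodPeriod (ellipticPeriod hτ₁) (ellipticPeriod hτ₂)) ↔
      (A : Matrix (Fin 2) (Fin 2) ℂ).det = (B : Matrix (Fin 2) (Fin 2) ℂ).det := by
  constructor
  · intro h
    -- the multiplier of `(A 0; 0 B)` is `det A = det B`
    obtain ⟨c, hA, hB⟩ := exists_extGL_mem_of_blockDiagGL_mem_mumfordTateGroupC_prod _ _ (ellipticForm_I_smul hτ₁)
      ⟨_, map_ratCast_stdGram_eq_latticeGram_elliptic hτ₁⟩ (latticeGram_elliptic_ne_zero hτ₁) (ellipticForm_I_smul hτ₂)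
      ⟨_, map_ratCast_stdGram_eq_latticeGram_elliptic hτ₂⟩ h
    rw [(extGL_mem_extMumfordTateGroupC_ellipticPeriod_iff_of_eq_bot hτ₁ h₁).1 hA,
      (extGL_mem_extMumfordTateGroupC_ellipticPeriod_iff_of_eq_bot hτ₂ h₂).1 hB]
  · intro hdet
    exact fst_mem_mumfordTateGroupC_of_extGL_mem _
      ((extGL_blockDiagGL_mem_extMumfordTateGroupC_prod_ellipticPeriod_iff_of_eq_bot_of_eq_bot hτ₁ hτ₂ h₁ h₂ hiso
        (c := Matrix.GeneralLinearGroup.det A)).2 ⟨rfl, by rw [← hdet]; rfl⟩)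

end EllipticCurves

end ComplexTorus

end Literature.Geometry.Kaehler
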